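import Summits.AtomisticToContinuum.BoseEinsteinCondensation.Theorems.GaussianDominationCan.Negative.LoadBearing
import Summits.AtomisticToContinuum.BoseEinsteinCondensation.Theorems.GaussianDominationCan.Negative.FreeConstant
import Literature.MathematicalPhysics.QuantumManyBody.OneBodyCurrentGain
import Literature.MathematicalPhysics.QuantumManyBody.PeriodicFeynmanKacFreeForm
import HarnessLib.Audit

/-!
# Line `ward-chord-splitting` — crux `GaussianDominationCan` (stmt-AtomisticToContinuum-9479)

Crux-plan skeleton (planner, 2026-08-16) for the crux idea
`Cruxes/GaussianDominationCan/Ideas/ward-chord-splitting.md` (≈ `gauge-split-backflow.md`, same lever; triage r1: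
pass, pass, fail §A), route `BECThomsonPrinciple` (rank 2, the route's hardest item).

**Crux.** `GaussianDominationCan`: `∀ v ∀ M ∃ ρ₀ C N₀ …` the chord
`E₀^per + s·2N|∫ conj Φ · e^{ik·x₀} · Θ| ≤ E_v(Φ) + C s² L²/‖n‖∞²` for the LNSS source `Λ_k† = a_k†a_0 n̂₀^{-1/2}`
(`Θ = P₀ n̂₀^{-1/2} Φ`), all `s ≥ 0`, all periodic Bose trial states `Φ`, uniformly in `N`, `L` (window
`|k|∞ ≤ M√ρ`).

**Lever (the Ward chord) — PROVED here.** For a real periodic one-body phase `f`, `Φ ↦ e^{-it∑ⱼ f(xⱼ)}Φ` preserves the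
trial class and the interaction, and `T(e^{-itF}Φ) = T(Φ) - t·2∫∇f·j_Φ + t²∫|∇f|² n_Φ` EXACTLY (tree:
`periodicForm_phaseMul`, `cellKineticEnergy_phaseMul`); minimising over `t = ±s` against `E ≥ E₀` gives the chord
`E₀ + s|2∫∇f·j_Φ| ≤ E(Φ) + s² N ‖∇f‖∞²` — Gaussian domination with the FREE (f-sum) constant for every CURRENT source,
every `v ≥ 0` (hard cores included), every `N`, `L`.  With `f = sin(k·x + θ)` it settles the longitudinal current
quadrature `Im W_θ(Φ) = ∑ᵢ∫cos(k·xᵢ+θ) Im(conj Φ k·∇ᵢΦ)` (`wardChord : WardChord`, section `WardProof`, sorry-free,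
axioms propext/choice/Quot.sound).  The algebra that makes this bite on the crux: per particle, with
`A = (k·p) ∘ e^{ik·x}`, `P` = cell average, `Q = 1 - P`: `P A = 0` on periodic functions and `A P = |k|² e^{ik·x} P`, so
`|k|² ⟨a_k†a_0⟩_Φ = ⟨∑ᵢ Aᵢ⟩_Φ - ∑ᵢ⟨QᵢΦ, Aᵢ QᵢΦ⟩`, and
`⟨∑ᵢ Aᵢ⟩_Φ = (|k|²/2)·∑ᵢ∫e^{ik·xᵢ}|Φ|² + ∑ᵢ∫e^{ik·xᵢ} Im(conj Φ k·∇ᵢΦ)` (`kCurrent`: one half `|k|² ×` DENSITY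
wave + longitudinal CURRENT). Hence the c-number condensate source `X = ⟨a_k†a_0⟩` is
(Ward-controlled current) + (density wave) − (BACKFLOW `R` = the longitudinal current with both condensate legs
removed, `∑_{p∉{0,-k}} k·(p+k) a†_{p+k}a_p`).

**Also PROVED here:** `weakDensityChord_of_densityResponse : BECThomsonPrinciple.DensityResponse → WeakDensityChord` —
stub S2 is a corollary of the route's rank-4 sibling crux (translation `Φ ↦ Φ(· - t𝟙)`, `t = (θ/|k|²)k`, produces the
phase: `PeriodicTrialState.exists_translate`, `periodicEnergy_translate`, `setIntegral_cellN_comp_add_of_periodic`;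
section `Bridge`); and §A (triage r1-3) both ways: `cnumberGD_of`, `backflowChord_of_cnumberGD`.

**Stubs** (3; statements `Goal.stub_*` = the defs below; hardest = `stub_backflowChord`):
* S2 `stub_weakDensityChord : WeakDensityChord` — the density-wave chord `E₀ + s|D_θ(Φ)| ≤ E + C s² N L²/‖n‖∞²`,
  `D_θ(Φ) = ∫(∑ᵢcos(k·xᵢ+θ))|Φ|²`, in the crux's window: literally `DensityResponse` with `ρa` dropped from the
  denominator, a free phase `θ`, and the factor `2` moved into `s` — closes the moment `DensityResponse` lands
  (theorem above); open on its own (a curvature bound at `s → 0`, budget `N/k²` instead of `N/(k²+ρa)`).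
* S3 `stub_backflowChord : BackflowChord` — THE OPEN CORE: the chord for the no-condensate-leg longitudinal current
  `backflow = kCurrent - |k|²·X` with budget `C s² N|k|²` (k-free susceptibility `|⟨R⟩|² ≤ 4CN|k|²(E-E₀)`), in the window.
  HONEST STATUS (triage r1-3 §A, a theorem here): modulo the proved Ward chord and S2, S3 is EQUIVALENT to c-number
  Gaussian domination `CNumberGD` (chord for `X = ⟨a_k†a_0⟩`, budget `N L²/‖n‖²`, both quadratures); the split does
  not shrink the logical content of the phase half, it re-expresses it as a bound on an operator with no condensate
  leg, whose Bogoliubov susceptibility is `O(√(ρa³)·(kξ)²(1+log(1/kξ)))` of the budget plus a one-phonon vertex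
  suppressed by `(1-√x)²` at cubic order (triage r1-1/r1-2) — quantitative room, no new mechanism.
  Why it might fail: `ρ_s → 0` at scale `L` blows up `κ(J^cond)` and `κ(R)` together (§A).
* S4 `stub_normalisationLift : NormalisationLift` — the transfer `CNumberGD → GaussianDominationCan`: from the
  c-number-normalised source `a_k†a_0/√N` (∑ᵢ form) to the LNSS source `a_k†a_0 n̂₀^{-1/2}` (Bose symmetry:
  `∑ᵢ → (m+1)×` particle `0`; Josephson factor `1/x`).  BEC-STRENGTH on grossly uncondensed trial states (needs a
  condensate-fluctuation input for near-minimisers: card `gauge-split-backflow` NormalisationLift, triage r1-2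
  sharpen 2); size L–XL; the lead may split it (≤ 3 children) once the fluctuation input is typed.
* Compositions (kernel-checked, pure algebra on the chords — square forms `F² ≤ 4c(E-E₀)`, the identity
  `|k|²X = kCurrent - R`, `‖kCurrent‖ ≤ (|k|²/2)(|D₀|+|D₁|) + |Im W₀| + |Im W₁|`, Cauchy–Schwarz, `k∞² ≤ |k|² ≤ 3k∞²`,
  `k∞²L²/‖n‖² = 4π²`): `cnumberGD_of : WardChord → S2 → S3 → CNumberGD`;
  `backflowChord_of_cnumberGD : WardChord → S2 → CNumberGD → S3` (§A);
  `GaussianDominationCan_of : S2 → S3 → S4 → BECThomsonPrinciple.GaussianDominationCan` (with the proved `wardChord`;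
  target by `gaussianDominationCan_iff`, Negative/CruxForms); variant
  `GaussianDominationCan_of_densityResponse : S3 → S4 → BECThomsonPrinciple.DensityResponse → GaussianDominationCan`
  (the sibling route item in place of S2); `GaussianDominationCan_proof` = `_of` on the three stubs.

**Disproof / Negative lemmas used** (`Theorems/GaussianDominationCan/Negative/*`, imported; `Disproof.lean` itself is not
mounted on this hub — its content is known through the landed files and the item's evidence notes):
`gaussianDominationCan_iff` (crux = `∀ v M ∃ ρ₀ C N₀, GDCanWith`, `Iff.rfl`) is the target of S4 and of `_of`;
`forall_gdIneq_iff`/`forall_chord_iff` (chord ⇔ square) is the form in which the chords are combined;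
`gaussianDominationCan_false_without_n_ne_zero` — `n ≠ 0` is a hypothesis of S2, S3, `CNumberGD` and is USED
(`ksq_pos`, `one_le_norm_intVec`; `WardChord` holds at `n = 0` trivially: `k = 0`);
`gaussianDominationCan_false_without_symm` — Bose symmetry is used exactly once, inside S4 (`∑ᵢ ↦ (m+1)·` particle `0`);
`gaussianDominationCan_iff_noN₀` — we keep `N₀` (and use `N₀ ≥ 1`); `free_const_ge` / `not_gaussianDominationCan_sharp`
(`C ≥ 1/4π²`) — consistent: `WardChord` carries the free f-sum constant, the composed constant is
`10 + 120π²C₂ + 20C₃ ≫ 1/4π²`.  No landed Negative lemma refutes an instance of S2–S4.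
-/

namespace Summit.AtomisticToContinuum.BoseEinsteinCondensation.Cruxes.GaussianDominationCan.WardChordSplitting

open MeasureTheory
open scoped ENNReal ComplexConjugate
open Literature.MathematicalPhysics.QuantumManyBody.BoseGas
open Summit.AtomisticToContinuum.BoseEinsteinCondensation.Theses
open Summit.AtomisticToContinuum.BoseEinsteinCondensation.Theorems.GaussianDominationCan.Negative

noncomputable section

/-! ### Vocabulary of the line (all over existing declarations) -/

section Vocabulary

variable {N : ℕ} {L : ℝ}

/-- The wave vector `k = (2π/L)·n ∈ ℝ³`. -/
def kvec (L : ℝ) (n : Fin 3 → ℤ) : Space := WithLp.toLp 2 fun j => 2 * Real.pi / L * (n j : ℝ)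

/-- `|k|² = (2π/L)² ∑ⱼ nⱼ²` (Euclidean). -/
def ksq (L : ℝ) (n : Fin 3 → ℤ) : ℝ := (2 * Real.pi / L) ^ 2 * ∑ j, (n j : ℝ) ^ 2

/-- The crux's sup-norm wavenumber squared `k∞² = (2π‖n‖∞/L)²` (`k∞² ≤ |k|² ≤ 3k∞²`). -/
def ksupSq (L : ℝ) (n : Fin 3 → ℤ) : ℝ := (2 * Real.pi * ‖(fun j => (n j : ℝ))‖ / L) ^ 2

/-- The phase `k·x = (2π/L) ∑ⱼ nⱼ xⱼ` (literally the crux's exponent). -/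
def karg (L : ℝ) (n : Fin 3 → ℤ) (x : Space) : ℝ := 2 * Real.pi / L * ∑ j, (n j : ℝ) * x j

/-- `k·∇ᵢ g (X)` (directional derivative of `g` in particle `i` along `k`). -/
def kDeriv (L : ℝ) (n : Fin 3 → ℤ) (i : Fin N) (g : Config N → ℂ) (X : Config N) : ℂ :=
  fderiv ℝ g X (Pi.single i (kvec L n))

/-- **The phased current–density integral** `W_θ(Φ) = ∑ᵢ ∫_{cell^N} cos(k·xᵢ + θ) · conj(Φ(X)) · (k·∇ᵢΦ)(X) dX`.
Only its IMAGINARY part is used: `Im W_θ(Φ) = ∑ᵢ∫cos(k·xᵢ+θ) Im(conj Φ k·∇ᵢΦ) = ∫ ∇f·j_Φ` (`f = sin(k·x+θ)`), the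
longitudinal CURRENT quadrature, settled by the Ward chord (S1, proved). (Its real part is `|k|²/2 ×` the density wave
`D_{θ+π/2}` by parts — not needed.) -/
def phasedCurrent (θ : ℝ) (n : Fin 3 → ℤ) (Φ : PeriodicTrialState N L) : ℂ :=
  ∑ i : Fin N, ∫ X in cellN N L,
    (Real.cos (karg L n (X i) + θ) : ℂ) * ((starRingEnd ℂ) (Φ.ψ X) * kDeriv L n i Φ.ψ X)

/-- **The phased density wave** `D_θ(Φ) = ∫_{cell^N} (∑ᵢ cos(k·xᵢ + θ)) |Φ(X)|² dX` — for `θ = 0` literally one half of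
the source `∫(∑ᵢ 2cos(k·xᵢ))|Φ|²` of the route's crux `DensityResponse`; `D_{-π/2}` is the sine wave. -/
def densityWave (θ : ℝ) (n : Fin 3 → ℤ) (Φ : PeriodicTrialState N L) : ℝ :=
  ∫ X in cellN N L, (∑ i : Fin N, Real.cos (karg L n (X i) + θ)) * ‖Φ.ψ X‖ ^ 2

/-- **The c-number condensate source** `X(Φ) = ⟨Φ, ∑ᵢ e^{ik·xᵢ} Pᵢ Φ⟩ = ⟨Φ, a_k†a_0 Φ⟩`
(`Pᵢ` = cell average in particle `i` = the crux's `P`, here `cellAvg` of Negative/ProductCalculus; for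
Bose-symmetric `Φ` this is `(m+1) ∫ conj Φ · e^{ik·x₀} · P₀Φ`). -/
def condensateSource (n : Fin 3 → ℤ) (Φ : PeriodicTrialState N L) : ℂ :=
  ∑ i : Fin N, ∫ X in cellN N L,
    (starRingEnd ℂ) (Φ.ψ X) * Complex.exp (Complex.I * (karg L n (X i) : ℂ)) * cellAvg N L i Φ.ψ X

/-- **The full `k`-current** `K(Φ) = ⟨Φ, ∑ᵢ (k·pᵢ) e^{ik·xᵢ} Φ⟩ = ½|k|²⟨ρ_k⟩_Φ + ½⟨{k·pᵢ, e^{ik·xᵢ}}⟩_Φ`, written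
as `(|k|²/2)·(D₀ + i D_{-π/2}) + (Im W₀ + i Im W_{-π/2})`: one half `|k|² ×` the complex density wave
`∑ᵢ∫e^{ik·xᵢ}|Φ|² = D₀ + iD_{-π/2}` (`cos(· - π/2) = sin`) plus the longitudinal current
`J(Φ) = ∑ᵢ∫e^{ik·xᵢ} Im(conj Φ k·∇ᵢΦ)` (`p = -i∇`; `conj Φ·k·∇ᵢΦ = ½k·∇ᵢ|Φ|² + i Im(conj Φ k·∇ᵢΦ)` and one integration by
parts of `e^{ik·xᵢ}·½k·∇ᵢ|Φ|²` on the torus identify this with the operator expectation). In modes: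
`∑_p k·(p+k) ⟨a†_{p+k} a_p⟩` — NO `a_0†a_{-k}` leg, and the `p = 0` leg is `|k|² a_k†a_0`. -/
def kCurrent (n : Fin 3 → ℤ) (Φ : PeriodicTrialState N L) : ℂ :=
  ((ksq L n : ℂ) / 2) * ((densityWave 0 n Φ : ℂ) + Complex.I * (densityWave (-(Real.pi / 2)) n Φ : ℂ)) +
    (((phasedCurrent 0 n Φ).im : ℂ) + Complex.I * ((phasedCurrent (-(Real.pi / 2)) n Φ).im : ℂ))

/-- **The backflow (no-condensate-leg longitudinal current)**
`R(Φ) = kCurrent(Φ) - |k|² X(Φ) = ∑ᵢ ⟨QᵢΦ, (k·pᵢ) e^{ik·xᵢ} QᵢΦ⟩ = ∑_{p ∉ {0,-k}} k·(p+k) ⟨a†_{p+k} a_p⟩_Φ`,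
`Qᵢ = 1 - Pᵢ`: per particle `A = (k·p)∘e^{ik·x}` satisfies `P A = 0` on periodic `C¹` functions (the cell integral of an
`xᵢ`-derivative vanishes; `P` self-adjoint, `integral_conj_mul_cellAvg`) and `A P = |k|² e^{ik·x} P` (`PΦ` is
`xᵢ`-independent), so `A = |k|² e^{ik·x}P + QAQ` in expectation. -/
def backflow (n : Fin 3 → ℤ) (Φ : PeriodicTrialState N L) : ℂ :=
  kCurrent n Φ - (ksq L n : ℂ) * condensateSource n Φ

end Vocabulary

/-! ### The statements: S1 (proved below), stubs S2–S4, and the intermediate `CNumberGD` -/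

/-- **S1 — the Ward chord (f-sum rule in chord form; PROVED below, `wardChord`).** For every pair potential `v`, every
`N`, `L`, every mode `n` and phase `θ`, every `s ≥ 0` and every periodic trial state `Φ`:
`E₀^per(v,N,L) + s·|2 Im W_θ(Φ)| ≤ E_v(Φ) + s²·N|k|²`.
Proof plan: `f := sin(k·x + θ)` is `C¹` and `Lℤ³`-periodic with `∇f = k cos(k·x+θ)`; `Φ.phaseMul (t•f)` is a trial state,
so `E₀ ≤ E(e^{-it∑f(xⱼ)}Φ) = E(Φ) - GAIN(tf; Φ)` (`periodicForm_phaseMul`, `periodicEnergy_eq_periodicForm`), with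
`GAIN(tf;Φ) = 2t∫∇f·j_Φ - t²∫|∇f|²n_Φ` (`phaseGain`), `∫∇f·j_Φ = ∑ᵢ∫cos(k·xᵢ+θ) Im(conj Φ k·∇ᵢΦ) = Im W_θ(Φ)`
(`integral_sum_fderiv_mul_particleCurrent`, linearity of `fderiv` in the direction) and
`∫|∇f|²n_Φ = ∑ᵢ∫|k|²cos²(k·xᵢ+θ)|Φ|² ≤ N|k|²`; take `t = ±s`. Trivial when `E_v(Φ) = ⊤` (hard cores) and for `n = 0`
(`k = 0`, `W = 0`). No window, no density condition, no `IsRepulsiveFiniteRange`: an identity-level fact, now a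
theorem (`wardChord`), reusable verbatim by `GDTransfer`/`FibreConductance` provers (KLS second variation `c_k`).
[Griffin1993 §6.1 (6.1)–(6.3); LSSY2005 §5.2 (5.19)–(5.23); Simon 1976 universal diamagnetism] -/
def WardChord : Prop :=
  ∀ (v : ℝ → ℝ≥0∞) (N : ℕ) (L : ℝ) (n : Fin 3 → ℤ) (θ : ℝ) (s : ℝ), 0 ≤ s →
    ∀ Φ : PeriodicTrialState N L,
      periodicGroundStateEnergy v N L + ENNReal.ofReal (s * |2 * (phasedCurrent θ n Φ).im|) ≤
        periodicEnergy v Φ + ENNReal.ofReal (s ^ 2 * (N * ksq L n))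

/-- **S2 — the weak density chord (≤ the route's rank-4 crux `DensityResponse`: theorem
`weakDensityChord_of_densityResponse` below; open on its own).** For every admissible `v` and window `M` there are
`ρ₀, C, N₀` with: for `N ≥ N₀`, `L > 0`, `N ≤ ρ₀L³`, `n ≠ 0` in the window `2π‖n‖∞/L ≤ M√(N/L³)`, every phase `θ`, every
`s ≥ 0`, every `Φ`: `E₀^per + s·|D_θ(Φ)| ≤ E_v(Φ) + C s² N L²/‖n‖∞²` — the density-wave chord with the `ρa`-free budget
`N/k∞²` (`χ_ρρ(k) ≤ C'N/k²` uniformly down to `k = 2π/L`), i.e. `DensityResponse` with `ρa` dropped, a free phase `θ` and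
the factor `2` moved into `s`. From `DensityResponse`: translate `Φ ↦ Φ(· - t𝟙)` with `t = (θ/|k|²)k`
(`PeriodicTrialState.exists_translate`, `periodicEnergy_translate`, `setIntegral_cellN_comp_add_of_periodic`) — done below.
Free gas: Mathieu, `C = O(1)`; Bogoliubov: `χ_ρρ/N = 2/(k² + 16πρa) ≤ 2/k²`. Why it might fail (as a standalone target): as
`DensityResponse` at `s → 0` — a true curvature bound; anomalously soft low-`k` density weight is excluded by no printed
method — but with the weaker budget `N/k²` in place of `N/(k²+ρa)`. -/
def WeakDensityChord : Prop :=
  ∀ v : ℝ → ℝ≥0∞, IsRepulsiveFiniteRange v → ∀ M : ℝ, 0 < M →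
    ∃ ρ₀ C : ℝ, 0 < ρ₀ ∧ 0 < C ∧ ∃ N₀ : ℕ, ∀ N : ℕ, N₀ ≤ N → ∀ L : ℝ, 0 < L → (N : ℝ) ≤ ρ₀ * L ^ 3 →
      ∀ n : Fin 3 → ℤ, n ≠ 0 → 2 * Real.pi * ‖(fun j => (n j : ℝ))‖ / L ≤ M * Real.sqrt (N / L ^ 3) →
      ∀ (θ : ℝ) (s : ℝ), 0 ≤ s → ∀ Φ : PeriodicTrialState N L,
        periodicGroundStateEnergy v N L + ENNReal.ofReal (s * |densityWave θ n Φ|) ≤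
          periodicEnergy v Φ + ENNReal.ofReal (C * s ^ 2 * N * L ^ 2 / ‖(fun j => (n j : ℝ))‖ ^ 2)

/-- **S3 — the backflow chord (THE OPEN CORE; hardest stub).** For every admissible `v` and window `M` there are
`ρ₀, C, N₀` with: in the crux's regime (`N ≥ N₀`, `N ≤ ρ₀L³`, `n ≠ 0`, `2π‖n‖∞/L ≤ M√ρ`), every `s ≥ 0`, every `Φ`:
`E₀^per + s·|R(Φ)| ≤ E_v(Φ) + C s² N|k|²` for the no-condensate-leg current `R = backflow`
(`= ∑_{p∉{0,-k}} k·(p+k)⟨a†_{p+k}a_p⟩`), i.e. `|⟨R⟩_Φ|² ≤ 4CN|k|²(E_v(Φ) - E₀)`.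
Evidence: free gas `R Ψ₀ = 0`; Bogoliubov: one-phonon matrix element of `R` vanishes at quadratic order and is
`(1-√x)²`-suppressed at cubic order (f-sum matching), two-phonon susceptibility
`≈ √(ρa³)(kξ)²(O(1) + c₀ log(1/kξ))·N|k|²`-sized against the budget `C N|k|²` (triage r1-1, r1-2; j010367).
HONEST STATUS (triage r1-3 §A; theorems `cnumberGD_of`, `backflowChord_of_cnumberGD` below): modulo S1 ∧ S2 this is
EQUIVALENT to `CNumberGD` — the phase-and-density Gaussian domination of the c-number source `a_k†a_0/√N` — by
`|k|²X = kCurrent - R` and the triangle inequality; the line's claim is structural (no condensate leg, explicit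
infrared margin), not logical. Why it might fail: a world with `ρ_s → 0` at scale `L` (`T = 0` phase stiffness, the
item's own why-might-fail) makes `κ(J^cond)` and `κ(R)` blow up together. Difficulty: open-problem. -/
def BackflowChord : Prop :=
  ∀ v : ℝ → ℝ≥0∞, IsRepulsiveFiniteRange v → ∀ M : ℝ, 0 < M →
    ∃ ρ₀ C : ℝ, 0 < ρ₀ ∧ 0 < C ∧ ∃ N₀ : ℕ, ∀ N : ℕ, N₀ ≤ N → ∀ L : ℝ, 0 < L → (N : ℝ) ≤ ρ₀ * L ^ 3 →
      ∀ n : Fin 3 → ℤ, n ≠ 0 → 2 * Real.pi * ‖(fun j => (n j : ℝ))‖ / L ≤ M * Real.sqrt (N / L ^ 3) →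
      ∀ s : ℝ, 0 ≤ s → ∀ Φ : PeriodicTrialState N L,
        periodicGroundStateEnergy v N L + ENNReal.ofReal (s * ‖backflow n Φ‖) ≤
          periodicEnergy v Φ + ENNReal.ofReal (C * s ^ 2 * (N * ksq L n))

/-- **c-number Gaussian domination** (the line's intermediate statement; NOT a stub — it is DERIVED from S1–S3 by
`cnumberGD_of`): the chord for the c-number condensate source `X(Φ) = ⟨Φ, ∑ᵢ e^{ik·xᵢ}PᵢΦ⟩ = ⟨a_k†a_0⟩_Φ` with the
crux's budget `×N`: `E₀^per + s|X(Φ)| ≤ E_v(Φ) + C s² N L²/‖n‖∞²` (i.e. `|⟨a_k†a_0⟩|² ≤ 4CN(L/‖n‖∞)²(E - E₀)`,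
Gaussian domination for `a_k†a_0/√N`, both quadratures). Bogoliubov: `x(u+v)²/e_k ≤ 1/k²` and `x k²/e_k² ≤ 1/k²`. -/
def CNumberGD : Prop :=
  ∀ v : ℝ → ℝ≥0∞, IsRepulsiveFiniteRange v → ∀ M : ℝ, 0 < M →
    ∃ ρ₀ C : ℝ, 0 < ρ₀ ∧ 0 < C ∧ ∃ N₀ : ℕ, ∀ N : ℕ, N₀ ≤ N → ∀ L : ℝ, 0 < L → (N : ℝ) ≤ ρ₀ * L ^ 3 →
      ∀ n : Fin 3 → ℤ, n ≠ 0 → 2 * Real.pi * ‖(fun j => (n j : ℝ))‖ / L ≤ M * Real.sqrt (N / L ^ 3) →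
      ∀ s : ℝ, 0 ≤ s → ∀ Φ : PeriodicTrialState N L,
        periodicGroundStateEnergy v N L + ENNReal.ofReal (s * ‖condensateSource n Φ‖) ≤
          periodicEnergy v Φ + ENNReal.ofReal (C * s ^ 2 * N * L ^ 2 / ‖(fun j => (n j : ℝ))‖ ^ 2)

/-- **S4 — the normalisation lift (transfer `CNumberGD → GaussianDominationCan`; size L–XL, BEC-strength).**
From the chord for the c-number-normalised source `∑ᵢ e^{ik·xᵢ}Pᵢ` (budget `C N L²/‖n‖²`) to the crux's chord for the
LNSS source `2(m+1)|∫ conj Φ · e^{ik·x₀} · Θ|`, `Θ = P₀ n̂₀^{-1/2}Φ = ∑_{S∋0}|S|^{-1/2}Q_SΦ` (budget `C L²/‖n‖²`), stated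
with the disprover's `GDCanWith` (the crux is `∀ v M ∃ ρ₀ C N₀, GDCanWith ρ₀ C N₀ v M` by `gaussianDominationCan_iff`,
`Iff.rfl`). Bose symmetry enters here (`∑ᵢ ↦ (m+1)×` particle `0`, `gaussianDominationCan_false_without_symm`), and so
does the Josephson factor: `Λ_k† = a_k†a_0 n̂₀^{-1/2}`, `χ̃(Λ) ≈ χ̃(X)/x` (`x = n₀/N`; ED j006865: ratio ∈ [0.87, 1.00]),
so the lift is BEC-STRENGTH on grossly uncondensed trial states: the crux demands `E(Φ) - E₀ ≳ k²n_k(Φ)/C` of them.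
Believed ingredients (card `gauge-split-backflow` NormalisationLift; triage r1-2 sharpen 2): `CNumberGD` for the
coupling path `t·v` + KLS mode counting (as in `GDTransfer`) ⇒ `𝔼[x̂(1-x̂)] ≤ ε` for near-minimisers; a
condensate-FLUCTUATION bound for near-minimisers (open; known in GP scaling only) to exclude the uncondensed branch;
continuity in `t` at fixed `(N,L)` (Perron–Frobenius); then division by `x ≥ 1 - ε'` and the trivial bound
`‖Λ‖ ≤ √(N+1)` on far states (`s ≥ 2k²√N/C`). Why it might fail: the fluctuation input is itself of condensation
type — this stub carries the condensate-fraction content of the crux in one named place. -/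
def NormalisationLift : Prop :=
  CNumberGD → ∀ v : ℝ → ℝ≥0∞, IsRepulsiveFiniteRange v → ∀ M : ℝ, 0 < M →
    ∃ ρ₀ C : ℝ, 0 < ρ₀ ∧ 0 < C ∧ ∃ N₀ : ℕ, GDCanWith ρ₀ C N₀ v M

/-! ### Audit names of the stub statements

`Goal.stub_x` abbreviates the statement of the registered stub `stub_x`, so that the skeleton audit
(`#h21_check_skeleton`, by-name policy on hypothesis heads) reads the hypotheses of `GaussianDominationCan_of` as
exactly the three declared stubs (S1 is proved below: `wardChord`). -/

namespace Goal

/-- Statement of stub S2 `stub_weakDensityChord`. -/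
abbrev stub_weakDensityChord : Prop := WeakDensityChord

/-- Statement of stub S3 `stub_backflowChord`. -/
abbrev stub_backflowChord : Prop := BackflowChord

/-- Statement of stub S4 `stub_normalisationLift`. -/
abbrev stub_normalisationLift : Prop := NormalisationLift

end Goal

/-! ### Registered stubs -/

/-- S2 (open; ≤ DensityResponse): the weak density chord. -/
theorem stub_weakDensityChord : WeakDensityChord := by
  sorry

/-- S3 (open-problem, hardest): the backflow chord. -/
theorem stub_backflowChord : BackflowChord := by
  sorry

/-- S4 (L–XL, BEC-strength): the normalisation lift. -/
theorem stub_normalisationLift : NormalisationLift := by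
  sorry

/-! ### Elementary lemmas for the composition (sorry-free) -/

section Lemmas

variable {N : ℕ} {L : ℝ}

/-- `|k|² ≥ 0`. [folklore] -/
theorem ksq_nonneg (L : ℝ) (n : Fin 3 → ℤ) : 0 ≤ ksq L n := by
  unfold ksq
  exact mul_nonneg (sq_nonneg _) (Finset.sum_nonneg fun j _ => sq_nonneg _)

/-- `|k|² > 0` for `n ≠ 0`, `L ≠ 0`. [folklore] -/
theorem ksq_pos {L : ℝ} (hL : L ≠ 0) {n : Fin 3 → ℤ} (hn : n ≠ 0) : 0 < ksq L n := by
  obtain ⟨j, hj⟩ := Function.ne_iff.mp hn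
  have h1 : (1 : ℝ) ≤ (n j : ℝ) ^ 2 := by
    have h1' : (1 : ℤ) ≤ (n j) ^ 2 := by
      have := Int.one_le_abs hj
      nlinarith [sq_abs (n j), abs_nonneg (n j)]
    exact_mod_cast h1'
  have h2 : (n j : ℝ) ^ 2 ≤ ∑ i, (n i : ℝ) ^ 2 :=
    Finset.single_le_sum (f := fun i => (n i : ℝ) ^ 2) (fun i _ => sq_nonneg _) (Finset.mem_univ j)
  have h3 : 0 < (2 * Real.pi / L) ^ 2 := by
    have : 2 * Real.pi / L ≠ 0 := div_ne_zero (by positivity) hL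
    positivity
  unfold ksq
  exact mul_pos h3 (by linarith)

/-- `k∞² ≤ |k|²` (sup norm versus Euclidean norm of the mode). [folklore] -/
theorem ksupSq_le_ksq (L : ℝ) (n : Fin 3 → ℤ) : ksupSq L n ≤ ksq L n := by
  unfold ksupSq ksq
  have hsum : 0 ≤ ∑ j, (n j : ℝ) ^ 2 := Finset.sum_nonneg fun j _ => sq_nonneg _
  have hnorm : ‖(fun j => (n j : ℝ))‖ ≤ Real.sqrt (∑ j, (n j : ℝ) ^ 2) := by
    refine (pi_norm_le_iff_of_nonneg (Real.sqrt_nonneg _)).2 fun i => ?_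
    rw [Real.norm_eq_abs]
    exact Real.abs_le_sqrt
      (Finset.single_le_sum (f := fun j => (n j : ℝ) ^ 2) (fun j _ => sq_nonneg _) (Finset.mem_univ i))
  have h0 : 0 ≤ ‖(fun j => (n j : ℝ))‖ := norm_nonneg _
  have hsq : ‖(fun j => (n j : ℝ))‖ ^ 2 ≤ ∑ j, (n j : ℝ) ^ 2 := by
    calc ‖(fun j => (n j : ℝ))‖ ^ 2 ≤ Real.sqrt (∑ j, (n j : ℝ) ^ 2) ^ 2 := pow_le_pow_left₀ h0 hnorm 2
      _ = ∑ j, (n j : ℝ) ^ 2 := Real.sq_sqrt hsum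
  have : (2 * Real.pi * ‖(fun j => (n j : ℝ))‖ / L) ^ 2 =
      (2 * Real.pi / L) ^ 2 * ‖(fun j => (n j : ℝ))‖ ^ 2 := by ring
  rw [this]
  exact mul_le_mul_of_nonneg_left hsq (sq_nonneg _)

/-- `|k|² ≤ 3 k∞²`. [folklore] -/
theorem ksq_le_three_mul_ksupSq (L : ℝ) (n : Fin 3 → ℤ) : ksq L n ≤ 3 * ksupSq L n := by
  unfold ksupSq ksq
  have hj : ∀ j : Fin 3, (n j : ℝ) ^ 2 ≤ ‖(fun j => (n j : ℝ))‖ ^ 2 := fun j => by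
    have h := norm_le_pi_norm (fun j : Fin 3 => (n j : ℝ)) j
    rw [Real.norm_eq_abs] at h
    calc (n j : ℝ) ^ 2 = |(n j : ℝ)| ^ 2 := (sq_abs _).symm
      _ ≤ ‖(fun j => (n j : ℝ))‖ ^ 2 := pow_le_pow_left₀ (abs_nonneg _) h 2
  have hsum : ∑ j, (n j : ℝ) ^ 2 ≤ 3 * ‖(fun j => (n j : ℝ))‖ ^ 2 := by
    rw [Fin.sum_univ_three]
    linarith [hj 0, hj 1, hj 2]
  have : 3 * (2 * Real.pi * ‖(fun j => (n j : ℝ))‖ / L) ^ 2 =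
      (2 * Real.pi / L) ^ 2 * (3 * ‖(fun j => (n j : ℝ))‖ ^ 2) := by ring
  rw [this]
  exact mul_le_mul_of_nonneg_left hsum (sq_nonneg _)

/-- `k∞² · L²/‖n‖∞² = 4π²`. [folklore] -/
theorem ksupSq_mul (hL : 0 < L) {n : Fin 3 → ℤ} (hn : n ≠ 0) :
    ksupSq L n * (L ^ 2 / ‖(fun j => (n j : ℝ))‖ ^ 2) = 4 * Real.pi ^ 2 := by
  unfold ksupSq
  have h1 : (0 : ℝ) < ‖(fun j => (n j : ℝ))‖ := lt_of_lt_of_le one_pos (one_le_norm_intVec hn)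
  field_simp
  ring

/-- Square form of a chord family: `a + sF ≤ e + cs²` for all `s ≥ 0` (`c > 0`, `F ≥ 0`) gives `F² ≤ 4c(e - a)`
(take `s = F/2c`). [folklore] -/
theorem sq_le_of_forall_chord {a e c F : ℝ} (hc : 0 < c) (hF : 0 ≤ F)
    (h : ∀ s : ℝ, 0 ≤ s → a + s * F ≤ e + c * s ^ 2) : F ^ 2 ≤ 4 * c * (e - a) := by
  have h1 := h (F / (2 * c)) (by positivity)
  have e1 : F / (2 * c) * F = 2 * (F ^ 2 / (4 * c)) := by field_simp; ring
  have e2 : c * (F / (2 * c)) ^ 2 = F ^ 2 / (4 * c) := by field_simp; ring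
  rw [e1, e2] at h1
  have h2 : F ^ 2 / (4 * c) ≤ e - a := by linarith
  have h3 := (div_le_iff₀ (by positivity : (0 : ℝ) < 4 * c)).mp h2
  linarith

/-- Chord family from the square form: `F² ≤ 4c(e - a)` (`c > 0`) gives `a + sF ≤ e + cs²` for all `s`
(`4csF ≤ F² + 4c²s²`). [folklore] -/
theorem forall_chord_of_sq_le {a e c F : ℝ} (hc : 0 < c) (h : F ^ 2 ≤ 4 * c * (e - a)) (s : ℝ) :
    a + s * F ≤ e + c * s ^ 2 := by
  have h1 : 0 ≤ (2 * c * s - F) ^ 2 := sq_nonneg _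
  have h2 : 4 * c * (s * F) ≤ 4 * c * (c * s ^ 2 + (e - a)) := by nlinarith [h1, h]
  have h3 : s * F ≤ c * s ^ 2 + (e - a) := le_of_mul_le_mul_left h2 (by positivity)
  linarith

/-- Reading an `ℝ≥0∞` chord at a finite-energy state as a real inequality. [folklore] -/
theorem ennreal_chord_iff {E₀ E : ℝ≥0∞} (hE : E ≠ ⊤) (hle : E₀ ≤ E) {x y : ℝ} (hx : 0 ≤ x) (hy : 0 ≤ y) :
    E₀ + ENNReal.ofReal x ≤ E + ENNReal.ofReal y ↔ E₀.toReal + x ≤ E.toReal + y := by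
  have hE₀ : E₀ ≠ ⊤ := ne_top_of_le_ne_top hE hle
  set a := E₀.toReal with ha
  set e := E.toReal with he
  rw [← ENNReal.ofReal_toReal hE₀, ← ENNReal.ofReal_toReal hE, ← ha, ← he,
    ← ENNReal.ofReal_add ENNReal.toReal_nonneg hx, ← ENNReal.ofReal_add ENNReal.toReal_nonneg hy,
    ENNReal.ofReal_le_ofReal_iff (by positivity)]

/-- The square form of an `ℝ≥0∞` chord family `E₀ + sF ≤ E + c s²` (all `s ≥ 0`) at a finite-energy state:
`F² ≤ 4c(E - E₀)`. [folklore] -/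
theorem sq_le_of_ennreal_chords {E₀ E : ℝ≥0∞} (hE : E ≠ ⊤) (hle : E₀ ≤ E) {F c : ℝ} (hF : 0 ≤ F)
    (hc : 0 < c)
    (h : ∀ s : ℝ, 0 ≤ s → E₀ + ENNReal.ofReal (s * F) ≤ E + ENNReal.ofReal (c * s ^ 2)) :
    F ^ 2 ≤ 4 * c * (E.toReal - E₀.toReal) :=
  sq_le_of_forall_chord hc hF fun s hs =>
    (ennreal_chord_iff hE hle (mul_nonneg hs hF) (by positivity)).mp (h s hs)

/-- `|2x|² ≤ 4bd` gives `|x|² ≤ bd`. [folklore] -/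
theorem abs_sq_le_of_two_mul {x b d : ℝ} (h : |2 * x| ^ 2 ≤ 4 * b * d) : |x| ^ 2 ≤ b * d := by
  rw [abs_mul, abs_two, mul_pow] at h
  linarith

/-- `‖kCurrent‖ ≤ (|k|²/2)(|D₀| + |D₁|) + |Im W₀| + |Im W₁|` (`·₁ = ·_{-π/2}`). [folklore] -/
theorem norm_kCurrent_le (n : Fin 3 → ℤ) (Φ : PeriodicTrialState N L) :
    ‖kCurrent n Φ‖ ≤ ksq L n / 2 * |densityWave 0 n Φ| + ksq L n / 2 * |densityWave (-(Real.pi / 2)) n Φ| +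
      (|(phasedCurrent 0 n Φ).im| + |(phasedCurrent (-(Real.pi / 2)) n Φ).im|) := by
  unfold kCurrent
  have hk : 0 ≤ ksq L n / 2 := by have := ksq_nonneg L n; positivity
  have h1 : ∀ a b : ℝ, ‖((a : ℂ) + Complex.I * (b : ℂ))‖ ≤ |a| + |b| := by
    intro a b
    calc ‖((a : ℂ) + Complex.I * (b : ℂ))‖ ≤ ‖(a : ℂ)‖ + ‖Complex.I * (b : ℂ)‖ := norm_add_le _ _
      _ = |a| + |b| := by rw [norm_mul, Complex.norm_I, one_mul, Complex.norm_real, Complex.norm_real,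
          Real.norm_eq_abs, Real.norm_eq_abs]
  calc ‖((ksq L n : ℂ) / 2) * ((densityWave 0 n Φ : ℂ) + Complex.I * (densityWave (-(Real.pi / 2)) n Φ : ℂ)) +
        (((phasedCurrent 0 n Φ).im : ℂ) + Complex.I * ((phasedCurrent (-(Real.pi / 2)) n Φ).im : ℂ))‖
      ≤ ‖((ksq L n : ℂ) / 2) * ((densityWave 0 n Φ : ℂ) + Complex.I * (densityWave (-(Real.pi / 2)) n Φ : ℂ))‖ +
          ‖(((phasedCurrent 0 n Φ).im : ℂ) + Complex.I * ((phasedCurrent (-(Real.pi / 2)) n Φ).im : ℂ))‖ :=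
        norm_add_le _ _
    _ ≤ ksq L n / 2 * (|densityWave 0 n Φ| + |densityWave (-(Real.pi / 2)) n Φ|) +
          (|(phasedCurrent 0 n Φ).im| + |(phasedCurrent (-(Real.pi / 2)) n Φ).im|) := by
        refine add_le_add ?_ (h1 _ _)
        rw [norm_mul, show ‖((ksq L n : ℂ) / 2)‖ = ksq L n / 2 by
          rw [norm_div, Complex.norm_real, Real.norm_of_nonneg (ksq_nonneg L n), Complex.norm_two]]
        exact mul_le_mul_of_nonneg_left (h1 _ _) hk
    _ = _ := by ring

/-- The defining identity of the backflow read as `|k|²‖X‖ ≤ ‖kCurrent‖ + ‖R‖`. [folklore] -/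
theorem ksq_mul_norm_condensateSource_le (n : Fin 3 → ℤ) (Φ : PeriodicTrialState N L) :
    ksq L n * ‖condensateSource n Φ‖ ≤ ‖kCurrent n Φ‖ + ‖backflow n Φ‖ := by
  have hid : (ksq L n : ℂ) * condensateSource n Φ = kCurrent n Φ - backflow n Φ := by
    unfold backflow; ring
  calc ksq L n * ‖condensateSource n Φ‖ = ‖(ksq L n : ℂ) * condensateSource n Φ‖ := by
        rw [norm_mul, Complex.norm_real, Real.norm_of_nonneg (ksq_nonneg L n)]
    _ = ‖kCurrent n Φ - backflow n Φ‖ := by rw [hid]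
    _ ≤ ‖kCurrent n Φ‖ + ‖backflow n Φ‖ := norm_sub_le _ _

/-- … and as `‖R‖ ≤ ‖kCurrent‖ + |k|²‖X‖` (for §A). [folklore] -/
theorem norm_backflow_le (n : Fin 3 → ℤ) (Φ : PeriodicTrialState N L) :
    ‖backflow n Φ‖ ≤ ‖kCurrent n Φ‖ + ksq L n * ‖condensateSource n Φ‖ := by
  unfold backflow
  calc ‖kCurrent n Φ - (ksq L n : ℂ) * condensateSource n Φ‖
      ≤ ‖kCurrent n Φ‖ + ‖(ksq L n : ℂ) * condensateSource n Φ‖ := norm_sub_le _ _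
    _ = ‖kCurrent n Φ‖ + ksq L n * ‖condensateSource n Φ‖ := by
        rw [norm_mul, Complex.norm_real, Real.norm_of_nonneg (ksq_nonneg L n)]

/-- Cauchy–Schwarz for five terms. [folklore] -/
theorem sq_sum_five_le (g₁ g₂ g₃ g₄ g₅ : ℝ) :
    (g₁ + g₂ + g₃ + g₄ + g₅) ^ 2 ≤ 5 * (g₁ ^ 2 + g₂ ^ 2 + g₃ ^ 2 + g₄ ^ 2 + g₅ ^ 2) := by
  nlinarith [sq_nonneg (g₁ - g₂), sq_nonneg (g₁ - g₃), sq_nonneg (g₁ - g₄), sq_nonneg (g₁ - g₅),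
    sq_nonneg (g₂ - g₃), sq_nonneg (g₂ - g₄), sq_nonneg (g₂ - g₅), sq_nonneg (g₃ - g₄),
    sq_nonneg (g₃ - g₅), sq_nonneg (g₄ - g₅)]

/-- Five nonnegative terms with square bounds bound the square of anything below their sum. [folklore] -/
theorem sq_le_five_of_le_sum {T g₁ g₂ g₃ g₄ g₅ b₁ b₂ b₃ b₄ b₅ : ℝ} (hT0 : 0 ≤ T)
    (hT : T ≤ g₁ + g₂ + g₃ + g₄ + g₅) (h₁ : g₁ ^ 2 ≤ b₁) (h₂ : g₂ ^ 2 ≤ b₂) (h₃ : g₃ ^ 2 ≤ b₃)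
    (h₄ : g₄ ^ 2 ≤ b₄) (h₅ : g₅ ^ 2 ≤ b₅) : T ^ 2 ≤ 5 * (b₁ + b₂ + b₃ + b₄ + b₅) := by
  have h0 : T ^ 2 ≤ (g₁ + g₂ + g₃ + g₄ + g₅) ^ 2 := pow_le_pow_left₀ hT0 hT 2
  have hcs := sq_sum_five_le g₁ g₂ g₃ g₄ g₅
  linarith

end Lemmas

/-! ### S1 — the Ward chord, PROVED (the line's lever is a theorem)

The gauge function `g = t·sin(k·x + θ)`, its derivative `∂ₗg = t cos(k·x+θ) kₗ`, periodicity, the two integrands of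
the gain (`∑ₗ∂ₗg(xᵢ)J_{i,l} = t cos(k·xᵢ+θ) Im(conj Φ k·∇ᵢΦ)`, `∑ᵢ∑ₗ(∂ₗg(xᵢ))²|Φ|² ≤ N t²|k|²|Φ|²`), the gain
`GAIN(g;Φ) = 2t Im W_θ(Φ) - B`, `B ≤ t²N|k|²` (tree: `phaseGain`, `integral_sum_fderiv_mul_particleCurrent`,
`integral_sum_fderiv_sq_mul_norm_sq`), and the chord by `E₀ ≤ E(Φ.phaseMul g) = ofReal(T - GAIN) + V`
(`periodicForm_phaseMul`) with `t = ±s`. -/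

section WardProof

variable {N : ℕ} {L : ℝ}

/-! #### The gauge function `g = t·sin(k·x + θ)` -/

/-- The (scaled) gauge function `g(x) = t sin(k·x + θ)`. -/
def gaugeFun (L : ℝ) (n : Fin 3 → ℤ) (θ t : ℝ) (x : Space) : ℝ := t * Real.sin (karg L n x + θ)

/-- `k·x` as a continuous linear functional. -/
def kargCLM (L : ℝ) (n : Fin 3 → ℤ) : Space →L[ℝ] ℝ :=
  (2 * Real.pi / L) • ∑ j : Fin 3, (n j : ℝ) • PiLp.proj 2 (fun _ : Fin 3 => ℝ) j

theorem kargCLM_apply (L : ℝ) (n : Fin 3 → ℤ) (x : Space) : kargCLM L n x = karg L n x := by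
  simp only [kargCLM, karg, ContinuousLinearMap.smul_apply, ContinuousLinearMap.coe_sum',
    Finset.sum_apply, PiLp.proj_apply, smul_eq_mul]

theorem hasFDerivAt_karg (L : ℝ) (n : Fin 3 → ℤ) (x : Space) :
    HasFDerivAt (karg L n) (kargCLM L n) x := by
  have h : (karg L n) = fun y => kargCLM L n y := funext fun y => (kargCLM_apply L n y).symm
  rw [h]
  exact (kargCLM L n).hasFDerivAt

theorem kargCLM_single (L : ℝ) (n : Fin 3 → ℤ) (l : Fin 3) :
    kargCLM L n (EuclideanSpace.single l (1 : ℝ)) = 2 * Real.pi / L * (n l : ℝ) := by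
  rw [kargCLM_apply]
  unfold karg
  congr 1
  simp [Finset.sum_ite_eq']

theorem kvec_apply (L : ℝ) (n : Fin 3 → ℤ) (l : Fin 3) : kvec L n l = 2 * Real.pi / L * (n l : ℝ) := rfl

theorem contDiff_karg (L : ℝ) (n : Fin 3 → ℤ) : ContDiff ℝ 1 (karg L n) := by
  have h : (karg L n) = fun y => kargCLM L n y := funext fun y => (kargCLM_apply L n y).symm
  rw [h]; exact (kargCLM L n).contDiff

theorem contDiff_gaugeFun (L : ℝ) (n : Fin 3 → ℤ) (θ t : ℝ) : ContDiff ℝ 1 (gaugeFun L n θ t) :=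
  contDiff_const.mul (Real.contDiff_sin.comp ((contDiff_karg L n).add contDiff_const))

theorem hasFDerivAt_gaugeFun (L : ℝ) (n : Fin 3 → ℤ) (θ t : ℝ) (x : Space) :
    HasFDerivAt (gaugeFun L n θ t) ((t * Real.cos (karg L n x + θ)) • kargCLM L n) x := by
  unfold gaugeFun
  have h1 : HasFDerivAt (fun y => karg L n y + θ) (kargCLM L n) x :=
    (hasFDerivAt_karg L n x).add_const θ
  have h2 := (Real.hasDerivAt_sin (karg L n x + θ)).comp_hasFDerivAt x h1
  have h3 := h2.const_mul t
  rw [smul_smul] at h3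
  exact h3

/-- `∂ₗ g(x) = t cos(k·x + θ) k_l`. -/
theorem fderiv_gaugeFun_single (L : ℝ) (n : Fin 3 → ℤ) (θ t : ℝ) (x : Space) (l : Fin 3) :
    fderiv ℝ (gaugeFun L n θ t) x (EuclideanSpace.single l (1 : ℝ)) =
      t * Real.cos (karg L n x + θ) * kvec L n l := by
  rw [(hasFDerivAt_gaugeFun L n θ t x).fderiv, ContinuousLinearMap.smul_apply, kargCLM_single,
    kvec_apply, smul_eq_mul]

/-- `karg (x + L e_l) = karg x + 2π n_l` for `L ≠ 0`. -/
theorem karg_add_single (hL : L ≠ 0) (n : Fin 3 → ℤ) (x : Space) (l : Fin 3) :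
    karg L n (x + EuclideanSpace.single l L) = karg L n x + 2 * Real.pi * (n l : ℝ) := by
  unfold karg
  have : ∑ j, (n j : ℝ) * (x + EuclideanSpace.single l L) j = (∑ j, (n j : ℝ) * x j) + (n l : ℝ) * L := by
    simp only [PiLp.add_apply, EuclideanSpace.single_apply, mul_add, Finset.sum_add_distrib, mul_ite,
      mul_zero, Finset.sum_ite_eq', Finset.mem_univ, if_true]
  rw [this, mul_add]
  congr 1
  field_simp

theorem gaugeFun_periodic (hL : L ≠ 0) (n : Fin 3 → ℤ) (θ t : ℝ) (x : Space) (l : Fin 3) :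
    gaugeFun L n θ t (x + EuclideanSpace.single l L) = gaugeFun L n θ t x := by
  unfold gaugeFun
  rw [karg_add_single hL, show karg L n x + 2 * Real.pi * (n l : ℝ) + θ =
    karg L n x + θ + (n l : ℤ) * (2 * Real.pi) by ring, Real.sin_add_int_mul_two_pi]

/-! #### Direction linearity: `∑ₗ k_l ∂_{i,l}Φ = k·∇ᵢΦ` -/

theorem kvec_eq_sum (L : ℝ) (n : Fin 3 → ℤ) :
    kvec L n = ∑ l : Fin 3, (kvec L n l) • EuclideanSpace.single l (1 : ℝ) := by
  ext j
  simp [Finset.sum_apply, kvec_apply, Pi.single_apply]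

theorem pi_single_sum (i : Fin N) (v : Fin 3 → Space) :
    (Pi.single i (∑ l, v l) : Config N) = ∑ l, (Pi.single i (v l) : Config N) := by
  have h := map_sum (AddMonoidHom.single (fun _ : Fin N => Space) i) v Finset.univ
  simpa only [AddMonoidHom.single_apply] using h

theorem sum_kvec_mul_fderiv_single (L : ℝ) (n : Fin 3 → ℤ) (g : Config N → ℂ) (X : Config N)
    (i : Fin N) :
    ∑ l : Fin 3, (kvec L n l : ℂ) * fderiv ℝ g X (Pi.single i (EuclideanSpace.single l (1 : ℝ))) =
      kDeriv L n i g X := by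
  unfold kDeriv
  conv_rhs => rw [kvec_eq_sum L n, pi_single_sum]
  rw [map_sum]
  refine Finset.sum_congr rfl fun l _ => ?_
  rw [Pi.single_smul' i (kvec L n l) (EuclideanSpace.single l (1 : ℝ)), ContinuousLinearMap.map_smul,
    Complex.real_smul]

/-! #### `∑ₗ k_l² = |k|²` -/

theorem sum_kvec_sq (L : ℝ) (n : Fin 3 → ℤ) : ∑ l : Fin 3, kvec L n l ^ 2 = ksq L n := by
  simp only [kvec_apply, ksq, Finset.mul_sum]
  refine Finset.sum_congr rfl fun l _ => ?_
  ring

/-! #### The two integrands of the gain for the gauge function -/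

/-- Current integrand: `∑ₗ ∂ₗg(xᵢ) J_{i,l}(X) = t cos(k·xᵢ+θ) Im(conj Φ k·∇ᵢΦ)`. -/
theorem current_integrand_eq (L : ℝ) (n : Fin 3 → ℤ) (θ t : ℝ) (ψ : Config N → ℂ) (X : Config N)
    (i : Fin N) :
    ∑ l : Fin 3, fderiv ℝ (gaugeFun L n θ t) (X i) (EuclideanSpace.single l 1) * particleCurrent i l ψ X =
      t * (Real.cos (karg L n (X i) + θ) * ((starRingEnd ℂ) (ψ X) * kDeriv L n i ψ X).im) := by
  rw [← sum_kvec_mul_fderiv_single, Finset.mul_sum, Complex.im_sum, Finset.mul_sum, Finset.mul_sum]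
  refine Finset.sum_congr rfl fun l _ => ?_
  rw [fderiv_gaugeFun_single, particleCurrent]
  have : (starRingEnd ℂ) (ψ X) * ((kvec L n l : ℂ) * fderiv ℝ ψ X (Pi.single i (EuclideanSpace.single l 1)))
      = (kvec L n l : ℂ) * ((starRingEnd ℂ) (ψ X) * fderiv ℝ ψ X (Pi.single i (EuclideanSpace.single l 1))) := by
    ring
  rw [this, Complex.im_ofReal_mul]
  ring

/-- Density integrand: `∑ₗ (∂ₗg(xᵢ))² ‖Φ‖² = t² cos²(k·xᵢ+θ) |k|² ‖Φ‖² ≤ t²|k|²‖Φ‖²`. -/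
theorem density_integrand_le (L : ℝ) (n : Fin 3 → ℤ) (θ t : ℝ) (ψ : Config N → ℂ) (X : Config N) :
    ∑ i : Fin N, ∑ l : Fin 3, fderiv ℝ (gaugeFun L n θ t) (X i) (EuclideanSpace.single l 1) ^ 2 * ‖ψ X‖ ^ 2 ≤
      (N : ℝ) * (t ^ 2 * ksq L n * ‖ψ X‖ ^ 2) := by
  have hi : ∀ i : Fin N, ∑ l : Fin 3, fderiv ℝ (gaugeFun L n θ t) (X i) (EuclideanSpace.single l 1) ^ 2 * ‖ψ X‖ ^ 2
      ≤ t ^ 2 * ksq L n * ‖ψ X‖ ^ 2 := by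
    intro i
    have heq : ∑ l : Fin 3, fderiv ℝ (gaugeFun L n θ t) (X i) (EuclideanSpace.single l 1) ^ 2 * ‖ψ X‖ ^ 2
        = t ^ 2 * Real.cos (karg L n (X i) + θ) ^ 2 * ksq L n * ‖ψ X‖ ^ 2 := by
      simp_rw [fderiv_gaugeFun_single]
      rw [← sum_kvec_sq L n, Finset.mul_sum, Finset.sum_mul]
      refine Finset.sum_congr rfl fun l _ => ?_
      ring
    rw [heq]
    have hcos : Real.cos (karg L n (X i) + θ) ^ 2 ≤ 1 := by
      rw [sq_le_one_iff_abs_le_one]; exact Real.abs_cos_le_one _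
    have h0 : 0 ≤ t ^ 2 * ksq L n * ‖ψ X‖ ^ 2 := by
      have := ksq_nonneg L n; positivity
    calc t ^ 2 * Real.cos (karg L n (X i) + θ) ^ 2 * ksq L n * ‖ψ X‖ ^ 2
        = Real.cos (karg L n (X i) + θ) ^ 2 * (t ^ 2 * ksq L n * ‖ψ X‖ ^ 2) := by ring
      _ ≤ 1 * (t ^ 2 * ksq L n * ‖ψ X‖ ^ 2) := mul_le_mul_of_nonneg_right hcos h0
      _ = t ^ 2 * ksq L n * ‖ψ X‖ ^ 2 := one_mul _
  calc ∑ i : Fin N, ∑ l : Fin 3, fderiv ℝ (gaugeFun L n θ t) (X i) (EuclideanSpace.single l 1) ^ 2 * ‖ψ X‖ ^ 2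
      ≤ ∑ _i : Fin N, t ^ 2 * ksq L n * ‖ψ X‖ ^ 2 := Finset.sum_le_sum fun i _ => hi i
    _ = (N : ℝ) * (t ^ 2 * ksq L n * ‖ψ X‖ ^ 2) := by
        rw [Finset.sum_const, Finset.card_univ, Fintype.card_fin, nsmul_eq_mul]

/-! #### Integrability and `∫ ‖Φ‖² = 1` -/

theorem integral_norm_sq_eq_one (Φ : PeriodicTrialState N L) :
    ∫ X in cellN N L, ‖Φ.ψ X‖ ^ 2 = 1 := by
  have hint : Integrable (fun X => ‖Φ.ψ X‖ ^ 2) (volume.restrict (cellN N L)) :=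
    integrableOn_cellN ((Φ.contDiff.continuous.norm).pow 2) L
  have h := ofReal_integral_eq_lintegral_ofReal hint
    (Filter.Eventually.of_forall fun X => sq_nonneg _)
  simp_rw [← coe_nnnorm_sq_eq_ofReal] at h
  rw [Φ.norm_eq] at h
  have hnn : 0 ≤ ∫ X in cellN N L, ‖Φ.ψ X‖ ^ 2 := integral_nonneg fun X => sq_nonneg _
  have := congrArg ENNReal.toReal h
  rwa [ENNReal.toReal_ofReal hnn, ENNReal.toReal_one] at this

theorem continuous_kDeriv (L : ℝ) (n : Fin 3 → ℤ) (i : Fin N) {ψ : Config N → ℂ} (hψ : ContDiff ℝ 1 ψ) :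
    Continuous (kDeriv L n i ψ) := by
  unfold kDeriv
  exact (hψ.continuous_fderiv one_ne_zero).clm_apply continuous_const

theorem continuous_karg_comp (L : ℝ) (n : Fin 3 → ℤ) (i : Fin N) :
    Continuous fun X : Config N => karg L n (X i) :=
  (contDiff_karg L n).continuous.comp (continuous_apply i)

/-- The summand of `W_θ` is continuous (hence integrable on the cell). -/
theorem continuous_phasedIntegrand (L : ℝ) (n : Fin 3 → ℤ) (θ : ℝ) (i : Fin N) {ψ : Config N → ℂ}
    (hψ : ContDiff ℝ 1 ψ) :
    Continuous fun X : Config N =>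
      (Real.cos (karg L n (X i) + θ) : ℂ) * ((starRingEnd ℂ) (ψ X) * kDeriv L n i ψ X) := by
  refine (Complex.continuous_ofReal.comp (Real.continuous_cos.comp
    ((continuous_karg_comp L n i).add continuous_const))).mul ?_
  exact (Complex.continuous_conj.comp hψ.continuous).mul (continuous_kDeriv L n i hψ)

/-- `Im W_θ(Φ) = ∑ᵢ ∫ cos(k·xᵢ+θ) Im(conj Φ k·∇ᵢΦ)`. -/
theorem im_phasedCurrent (θ : ℝ) (n : Fin 3 → ℤ) (Φ : PeriodicTrialState N L) :
    (phasedCurrent θ n Φ).im =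
      ∑ i : Fin N, ∫ X in cellN N L,
        Real.cos (karg L n (X i) + θ) * ((starRingEnd ℂ) (Φ.ψ X) * kDeriv L n i Φ.ψ X).im := by
  unfold phasedCurrent
  rw [Complex.im_sum]
  refine Finset.sum_congr rfl fun i _ => ?_
  have hint : Integrable (fun X : Config N =>
      (Real.cos (karg L n (X i) + θ) : ℂ) * ((starRingEnd ℂ) (Φ.ψ X) * kDeriv L n i Φ.ψ X))
      (volume.restrict (cellN N L)) :=
    integrableOn_cellN (continuous_phasedIntegrand L n θ i Φ.contDiff) L
  have h := integral_im hint
  simp only [RCLike.im_to_complex] at h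
  rw [← h]
  refine integral_congr_ae (Filter.Eventually.of_forall fun X => ?_)
  simp only [Complex.im_ofReal_mul]

/-! #### The gain of the gauge function -/

/-- `GAIN(g; Φ) = 2t·Im W_θ(Φ) - B` with `0 ≤ B ≤ t² N|k|²`. -/
theorem phaseGain_gaugeFun (n : Fin 3 → ℤ) (θ t : ℝ) (Φ : PeriodicTrialState N L) :
    ∃ B : ℝ, B ≤ t ^ 2 * ((N : ℝ) * ksq L n) ∧
      phaseGain L N Φ.ψ (gaugeFun L n θ t) = 2 * (t * (phasedCurrent θ n Φ).im) - B := by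
  have hg : ContDiff ℝ 1 (gaugeFun L n θ t) := contDiff_gaugeFun L n θ t
  refine ⟨∫ X in cellN N L, ∑ i : Fin N, ∑ l : Fin 3,
      fderiv ℝ (gaugeFun L n θ t) (X i) (EuclideanSpace.single l 1) ^ 2 * ‖Φ.ψ X‖ ^ 2, ?_, ?_⟩
  · -- `B ≤ t² N |k|²`
    have hcont : Continuous fun X : Config N => ∑ i : Fin N, ∑ l : Fin 3,
        fderiv ℝ (gaugeFun L n θ t) (X i) (EuclideanSpace.single l 1) ^ 2 * ‖Φ.ψ X‖ ^ 2 :=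
      continuous_finsetSum _ fun i _ => continuous_finsetSum _ fun l _ =>
        (((continuous_fderiv_apply_single hg l).comp (continuous_apply i)).pow 2).mul
          ((Φ.contDiff.continuous.norm).pow 2)
    have h1 : ∫ X in cellN N L, ∑ i : Fin N, ∑ l : Fin 3,
        fderiv ℝ (gaugeFun L n θ t) (X i) (EuclideanSpace.single l 1) ^ 2 * ‖Φ.ψ X‖ ^ 2 ≤
        ∫ X in cellN N L, (N : ℝ) * (t ^ 2 * ksq L n * ‖Φ.ψ X‖ ^ 2) := by
      refine integral_mono (integrableOn_cellN hcont L) ?_ fun X => density_integrand_le L n θ t Φ.ψ X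
      exact integrableOn_cellN (continuous_const.mul (continuous_const.mul
        ((Φ.contDiff.continuous.norm).pow 2))) L
    have h2 : ∫ X in cellN N L, (N : ℝ) * (t ^ 2 * ksq L n * ‖Φ.ψ X‖ ^ 2) = t ^ 2 * ((N : ℝ) * ksq L n) := by
      have : (fun X => (N : ℝ) * (t ^ 2 * ksq L n * ‖Φ.ψ X‖ ^ 2)) =
          fun X => ((N : ℝ) * (t ^ 2 * ksq L n)) * ‖Φ.ψ X‖ ^ 2 := by funext X; ring
      rw [this, integral_const_mul, integral_norm_sq_eq_one, mul_one]; ring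
    linarith
  · -- the gain
    unfold phaseGain
    rw [← integral_sum_fderiv_mul_particleCurrent hg Φ.contDiff,
      ← integral_sum_fderiv_sq_mul_norm_sq hg Φ.contDiff]
    congr 1
    -- the current pairing `= t · Im W`
    have hW := im_phasedCurrent θ n Φ
    simp_rw [current_integrand_eq]
    rw [hW, Finset.mul_sum]
    congr 1
    rw [integral_finsetSum]
    · refine Finset.sum_congr rfl fun i _ => ?_
      exact integral_const_mul _ _
    · intro i _
      refine (integrableOn_cellN ?_ L)
      refine continuous_const.mul ((Real.continuous_cos.comp
        ((continuous_karg_comp L n i).add continuous_const)).mul ?_)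
      exact Complex.continuous_im.comp ((Complex.continuous_conj.comp Φ.contDiff.continuous).mul
        (continuous_kDeriv L n i Φ.contDiff))

/-! #### The Ward chord -/

theorem wardChord : WardChord := by
  intro v N L n θ s hs Φ
  cases N with
  | zero =>
    have h0 : phasedCurrent θ n Φ = 0 := by simp [phasedCurrent]
    rw [h0]
    simp only [Complex.zero_im, mul_zero, abs_zero, ENNReal.ofReal_zero, add_zero]
    exact (periodicGroundStateEnergy_le v Φ).trans le_self_add
  | succ m =>
    have hL : 0 < L := Φ.side_pos
    by_cases hE : periodicEnergy v Φ = ⊤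
    · rw [hE, top_add]; exact le_top
    -- the sign of the gauge amplitude
    set W := phasedCurrent θ n Φ with hW
    set t : ℝ := if 0 ≤ W.im then s else -s with ht
    have ht2 : t ^ 2 = s ^ 2 := by rw [ht]; split_ifs <;> ring
    have htW : t * W.im = s * |W.im| := by
      rw [ht]; split_ifs with h
      · rw [abs_of_nonneg h]
      · rw [abs_of_neg (not_le.mp h)]; ring
    -- the gauge-transformed trial state
    have hgc : ContDiff ℝ 1 (gaugeFun L n θ t) := contDiff_gaugeFun L n θ t
    have hgp : ∀ (x : Space) (l : Fin 3), gaugeFun L n θ t (x + EuclideanSpace.single l L) = gaugeFun L n θ t x :=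
      fun x l => gaugeFun_periodic hL.ne' n θ t x l
    have hvar : periodicGroundStateEnergy v (m + 1) L ≤ periodicEnergy v (Φ.phaseMul hgc hgp) :=
      periodicGroundStateEnergy_le v _
    -- energies through the gain identity
    set T := cellKineticEnergy L Φ.ψ with hT
    set V := ∫⁻ X in cellN (m + 1) L, periodicInteraction v L X * (‖Φ.ψ X‖₊ : ℝ≥0∞) ^ 2 with hV
    have hEΨ : periodicEnergy v (Φ.phaseMul hgc hgp) =
        ENNReal.ofReal (T - phaseGain L (m + 1) Φ.ψ (gaugeFun L n θ t)) + V := by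
      rw [periodicEnergy_eq_periodicForm, PeriodicTrialState.phaseMul_ψ]
      exact periodicForm_phaseMul v hgc Φ.contDiff L
    have hEΦ : periodicEnergy v Φ = ENNReal.ofReal T + V := by
      have h := periodicForm_phaseMul v (contDiff_const (c := (0 : ℝ))) Φ.contDiff L
      rw [phaseMul_zero, phaseGain_const, sub_zero] at h
      rw [periodicEnergy_eq_periodicForm]
      exact h
    obtain ⟨B, hB, hgain⟩ := phaseGain_gaugeFun n θ t Φ
    rw [← hW] at hgain
    -- `T - GAIN ≥ 0` (it is a kinetic energy)
    have hTG : 0 ≤ T - phaseGain L (m + 1) Φ.ψ (gaugeFun L n θ t) := by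
      rw [hT, ← cellKineticEnergy_phaseMul hgc Φ.contDiff L]
      exact cellKineticEnergy_nonneg L _
    have hT0 : 0 ≤ T := cellKineticEnergy_nonneg L _
    have hsW : 0 ≤ s * |2 * W.im| := mul_nonneg hs (abs_nonneg _)
    have hk0 : 0 ≤ s ^ 2 * (((m + 1 : ℕ) : ℝ) * ksq L n) := by
      have := ksq_nonneg L n; positivity
    -- assemble
    rw [hEΨ] at hvar
    rw [hEΦ]
    calc periodicGroundStateEnergy v (m + 1) L + ENNReal.ofReal (s * |2 * W.im|)
        ≤ ENNReal.ofReal (T - phaseGain L (m + 1) Φ.ψ (gaugeFun L n θ t)) + V +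
            ENNReal.ofReal (s * |2 * W.im|) := add_le_add hvar le_rfl
      _ = ENNReal.ofReal (T - phaseGain L (m + 1) Φ.ψ (gaugeFun L n θ t) + s * |2 * W.im|) + V := by
          rw [ENNReal.ofReal_add hTG hsW]; ring
      _ ≤ ENNReal.ofReal (T + s ^ 2 * (((m + 1 : ℕ) : ℝ) * ksq L n)) + V := by
          refine add_le_add (ENNReal.ofReal_le_ofReal ?_) le_rfl
          have hB' : B ≤ s ^ 2 * (((m + 1 : ℕ) : ℝ) * ksq L n) := by rw [← ht2]; exact hB
          rw [hgain, abs_mul, abs_two]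
          linarith [hB', htW]
      _ = ENNReal.ofReal T + V + ENNReal.ofReal (s ^ 2 * (((m + 1 : ℕ) : ℝ) * ksq L n)) := by
          rw [ENNReal.ofReal_add hT0 hk0]; ring

end WardProof

/-! ### S2 from the sibling crux: `DensityResponse → WeakDensityChord` (translation produces the phase) -/

section Bridge

variable {N : ℕ} {L : ℝ}

/-- `k·(x + y) = k·x + k·y`. [folklore] -/
theorem karg_add (L : ℝ) (n : Fin 3 → ℤ) (x y : Space) : karg L n (x + y) = karg L n x + karg L n y := by
  unfold karg
  rw [← mul_add, ← Finset.sum_add_distrib]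
  congr 1
  refine Finset.sum_congr rfl fun j _ => ?_
  rw [PiLp.add_apply, mul_add]

/-- `k·(x - y) = k·x - k·y`. [folklore] -/
theorem karg_sub (L : ℝ) (n : Fin 3 → ℤ) (x y : Space) : karg L n (x - y) = karg L n x - karg L n y := by
  have h := karg_add L n (x - y) y
  rw [sub_add_cancel] at h
  linarith

/-- `k·(c k) = c|k|²`. [folklore] -/
theorem karg_smul_kvec (L : ℝ) (n : Fin 3 → ℤ) (c : ℝ) : karg L n (c • kvec L n) = c * ksq L n := by
  unfold karg ksq
  simp only [PiLp.smul_apply, smul_eq_mul, kvec_apply, Finset.mul_sum]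
  refine Finset.sum_congr rfl fun j _ => ?_
  ring

/-- `cos(k·(x + L e_l) + c) = cos(k·x + c)`. [folklore] -/
theorem cos_karg_add_single (hL : L ≠ 0) (n : Fin 3 → ℤ) (c : ℝ) (x : Space) (l : Fin 3) :
    Real.cos (karg L n (x + EuclideanSpace.single l L) + c) = Real.cos (karg L n x + c) := by
  rw [karg_add_single hL, show karg L n x + 2 * Real.pi * (n l : ℝ) + c =
    karg L n x + c + (n l : ℤ) * (2 * Real.pi) by ring, Real.cos_add_int_mul_two_pi]

/-- The density-wave integrand with phase `c` is periodic in every particle and axis. [folklore] -/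
theorem densityIntegrand_periodic (hL : L ≠ 0) (n : Fin 3 → ℤ) (c : ℝ) (Φ : PeriodicTrialState N L)
    (Y : Config N) (j : Fin N) (k : Fin 3) :
    (∑ i : Fin N, Real.cos (karg L n ((Y + Pi.single j (EuclideanSpace.single k L) : Config N) i) + c)) *
        ‖Φ.ψ (Y + Pi.single j (EuclideanSpace.single k L))‖ ^ 2 =
      (∑ i : Fin N, Real.cos (karg L n (Y i) + c)) * ‖Φ.ψ Y‖ ^ 2 := by
  rw [Φ.periodic]
  congr 1
  refine Finset.sum_congr rfl fun i _ => ?_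
  rcases eq_or_ne i j with rfl | hij
  · rw [Pi.add_apply, Pi.single_eq_same, cos_karg_add_single hL]
  · rw [Pi.add_apply, Pi.single_eq_of_ne hij, add_zero]

/-- **Translation produces the phase**: for the translate `Ψ = Φ(· - t𝟙)` (`PeriodicTrialState.exists_translate`),
`D_0(Ψ) = D_{k·t}(Φ)` (shift of the fundamental cell, `setIntegral_cellN_comp_add_of_periodic`). [folklore] -/
theorem densityWave_translate (hL : 0 < L) (n : Fin 3 → ℤ) (Φ : PeriodicTrialState N L) (t : Space)
    {Ψ : PeriodicTrialState N L} (hΨ : Ψ.ψ = fun X => Φ.ψ (X - fun _ => t)) :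
    densityWave 0 n Ψ = densityWave (karg L n t) n Φ := by
  unfold densityWave
  set G : Config N → ℝ := fun Y => (∑ i : Fin N, Real.cos (karg L n (Y i) + karg L n t)) * ‖Φ.ψ Y‖ ^ 2
    with hG
  have hper : ∀ (Y : Config N) (j : Fin N) (k : Fin 3),
      G (Y + Pi.single j (EuclideanSpace.single k L)) = G Y := fun Y j k =>
    densityIntegrand_periodic hL.ne' n (karg L n t) Φ Y j k
  have hkarg : Continuous (karg L n) := (contDiff_karg L n).continuous
  have hcont : Continuous G :=
    (continuous_finsetSum _ fun i _ => Real.continuous_cos.comp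
      ((hkarg.comp (continuous_apply i)).add continuous_const)).mul ((Φ.contDiff.continuous.norm).pow 2)
  have hshift := setIntegral_cellN_comp_add_of_periodic hL
    (hcont.aestronglyMeasurable.restrict) hper (-(fun _ => t))
  have hint : (fun X : Config N => (∑ i : Fin N, Real.cos (karg L n (X i) + 0)) * ‖Ψ.ψ X‖ ^ 2) =
      fun X => G (X + -(fun _ => t)) := by
    funext X
    rw [hΨ, hG]
    simp only
    rw [show X + -(fun _ : Fin N => t) = X - fun _ => t from (sub_eq_add_neg X _).symm]
    congr 1
    refine Finset.sum_congr rfl fun i _ => ?_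
    rw [add_zero, Pi.sub_apply, karg_sub, sub_add_cancel]
  rw [hint, hshift]

/-- **`DensityResponse ⟹ WeakDensityChord`**: S2 follows from the route's rank-4 crux — drop `ρa ≥ 0` from the
denominator, translate by `t = (θ/|k|²)k` to produce the phase (`periodicEnergy_translate`: same energy), and absorb
the route's factor `2` into `s ↦ s/2`; `C₂ := C`, `ρ₀, N₀` unchanged. So `stub_weakDensityChord` closes the moment
`DensityResponse` lands (apply this theorem to the landed proof). -/
theorem weakDensityChord_of_densityResponse (hD : BECThomsonPrinciple.DensityResponse) : WeakDensityChord := by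
  intro v hv M hM
  obtain ⟨ρ₀, C, hρ₀, hC, N₀, h⟩ := hD v hv M hM
  refine ⟨ρ₀, C, hρ₀, hC, N₀, ?_⟩
  intro N hN L hL hNL n hn hwin θ s hs Φ
  -- the translate carrying the phase
  have hk : 0 < ksq L n := ksq_pos hL.ne' hn
  set t : Space := (θ / ksq L n) • kvec L n with ht
  have hkt : karg L n t = θ := by rw [ht, karg_smul_kvec]; field_simp
  obtain ⟨Ψ, hΨ⟩ := Φ.exists_translate t
  have hEΨ : periodicEnergy v Ψ = periodicEnergy v Φ := periodicEnergy_translate v Φ t hΨ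
  have hDΨ : densityWave 0 n Ψ = densityWave θ n Φ := by rw [densityWave_translate hL n Φ t hΨ, hkt]
  -- the route's source at `Ψ` is `2 D_0(Ψ)`
  have hsrc : ∫ X in cellN N L, (∑ i, 2 * Real.cos (2 * Real.pi / L * ∑ j, (n j : ℝ) * X i j)) * ‖Ψ.ψ X‖ ^ 2
      = 2 * densityWave 0 n Ψ := by
    unfold densityWave
    rw [← integral_const_mul]
    refine integral_congr_ae (Filter.Eventually.of_forall fun X => ?_)
    simp only [karg, add_zero]
    rw [← Finset.mul_sum]
    ring
  -- `DensityResponse` at `(s/2, Ψ)`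
  have key := h N hN L hL hNL n hn hwin (s / 2) (by positivity) Ψ
  rw [hsrc, hEΨ, hDΨ] at key
  have e1 : s / 2 * |2 * densityWave θ n Φ| = s * |densityWave θ n Φ| := by
    rw [abs_mul, abs_two]; ring
  rw [e1] at key
  refine key.trans (add_le_add le_rfl (ENNReal.ofReal_le_ofReal ?_))
  -- budgets: `C (s/2)² N/(k∞² + ρa) ≤ C s² N L²/‖n‖²`
  have hnorm : 1 ≤ ‖(fun j => (n j : ℝ))‖ := one_le_norm_intVec hn
  have hks : 0 < (2 * Real.pi * ‖(fun j => (n j : ℝ))‖ / L) ^ 2 := by positivity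
  have hden : (2 * Real.pi * ‖(fun j => (n j : ℝ))‖ / L) ^ 2 ≤
      (2 * Real.pi * ‖(fun j => (n j : ℝ))‖ / L) ^ 2 + (N : ℝ) / L ^ 3 * (scatteringLength v).toReal := by
    have : 0 ≤ (N : ℝ) / L ^ 3 * (scatteringLength v).toReal := by positivity
    linarith
  calc C * (s / 2) ^ 2 * N / ((2 * Real.pi * ‖(fun j => (n j : ℝ))‖ / L) ^ 2 +
        N / L ^ 3 * (scatteringLength v).toReal)
      ≤ C * (s / 2) ^ 2 * N / (2 * Real.pi * ‖(fun j => (n j : ℝ))‖ / L) ^ 2 := by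
        apply div_le_div_of_nonneg_left (by positivity) hks hden
    _ = C * s ^ 2 * N * L ^ 2 / ‖(fun j => (n j : ℝ))‖ ^ 2 * (1 / (16 * Real.pi ^ 2)) := by
        field_simp
        ring
    _ ≤ C * s ^ 2 * N * L ^ 2 / ‖(fun j => (n j : ℝ))‖ ^ 2 * 1 := by
        refine mul_le_mul_of_nonneg_left ?_ (by positivity)
        rw [div_le_one (by positivity)]
        nlinarith [Real.pi_gt_three]
    _ = C * s ^ 2 * N * L ^ 2 / ‖(fun j => (n j : ℝ))‖ ^ 2 := mul_one _

/-- The registered stub S2 as a corollary of the sibling crux, in the audit's vocabulary. -/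
theorem stub_weakDensityChord_of_densityResponse (hD : BECThomsonPrinciple.DensityResponse) :
    Goal.stub_weakDensityChord :=
  weakDensityChord_of_densityResponse hD

end Bridge

/-! ### The kernel-checked compositions -/

section Composition

variable {N : ℕ} {L : ℝ}

/-- The density term: from the chord square form `|D|² ≤ 4(C₂ N L²/‖n‖²)d` to
`((|k|²/2)|D|)² ≤ 12π²C₂·(N|k|²)·d`, using `|k|²L²/‖n‖² ≤ 12π²`. [folklore] -/
theorem density_term_sq {D C₂ Nr q k d : ℝ} (hk : 0 ≤ k) (hd : 0 ≤ d) (hC : 0 ≤ C₂ * Nr)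
    (hgeom : k * q ≤ 12 * Real.pi ^ 2) (hD' : |D| ^ 2 ≤ 4 * (C₂ * Nr * q) * d) :
    (k / 2 * |D|) ^ 2 ≤ 12 * Real.pi ^ 2 * C₂ * (Nr * k) * d := by
  have hD : D ^ 2 ≤ 4 * (C₂ * Nr * q) * d := by rwa [sq_abs] at hD'
  have h1 : (k / 2 * |D|) ^ 2 = k ^ 2 / 4 * D ^ 2 := by rw [mul_pow, sq_abs]; ring
  rw [h1]
  have h2 : k ^ 2 / 4 * D ^ 2 ≤ k ^ 2 / 4 * (4 * (C₂ * Nr * q) * d) :=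
    mul_le_mul_of_nonneg_left hD (by positivity)
  have h3 : k ^ 2 / 4 * (4 * (C₂ * Nr * q) * d) = C₂ * Nr * k * d * (k * q) := by ring
  have h4 : 0 ≤ C₂ * Nr * k * d := by positivity
  calc k ^ 2 / 4 * D ^ 2 ≤ C₂ * Nr * k * d * (k * q) := by rw [← h3]; exact h2
    _ ≤ C₂ * Nr * k * d * (12 * Real.pi ^ 2) := mul_le_mul_of_nonneg_left hgeom h4
    _ = 12 * Real.pi ^ 2 * C₂ * (Nr * k) * d := by ring

/-- `|k|² · L²/‖n‖∞² ≤ 12π²`. [folklore] -/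
theorem ksq_mul_geom_le (hL : 0 < L) {n : Fin 3 → ℤ} (hn : n ≠ 0) :
    ksq L n * (L ^ 2 / ‖(fun j => (n j : ℝ))‖ ^ 2) ≤ 12 * Real.pi ^ 2 := by
  calc ksq L n * (L ^ 2 / ‖(fun j => (n j : ℝ))‖ ^ 2)
      ≤ 3 * ksupSq L n * (L ^ 2 / ‖(fun j => (n j : ℝ))‖ ^ 2) :=
        mul_le_mul_of_nonneg_right (ksq_le_three_mul_ksupSq L n) (by positivity)
    _ = 3 * (ksupSq L n * (L ^ 2 / ‖(fun j => (n j : ℝ))‖ ^ 2)) := by ring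
    _ = 12 * Real.pi ^ 2 := by rw [ksupSq_mul hL hn]; ring

/-- **The splitting inequality at one state (square form).** With `d = E(Φ) - E₀` at a finite-energy state: if
`|2 Im W₀|², |2 Im W₁|² ≤ 4c_k d` (Ward), `|D₀|², |D₁|² ≤ 4(C₂N L²/‖n‖²)d` (density), `‖R‖² ≤ 4C₃c_k d` (backflow),
`c_k = N|k|²`, then `(|k|²‖X‖)² ≤ 5(2 + 24π²C₂ + 4C₃)·c_k·d`. -/
theorem splitting_sq (hL : 0 < L) {d C₂ C₃ : ℝ} {n : Fin 3 → ℤ} (hn : n ≠ 0) {Φ : PeriodicTrialState N L}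
    (hd : 0 ≤ d) (hC₂ : 0 ≤ C₂)
    (h₁ : |2 * (phasedCurrent 0 n Φ).im| ^ 2 ≤ 4 * ((N : ℝ) * ksq L n) * d)
    (h₂ : |2 * (phasedCurrent (-(Real.pi / 2)) n Φ).im| ^ 2 ≤ 4 * ((N : ℝ) * ksq L n) * d)
    (h₃ : |densityWave 0 n Φ| ^ 2 ≤ 4 * (C₂ * N * (L ^ 2 / ‖(fun j => (n j : ℝ))‖ ^ 2)) * d)
    (h₄ : |densityWave (-(Real.pi / 2)) n Φ| ^ 2 ≤ 4 * (C₂ * N * (L ^ 2 / ‖(fun j => (n j : ℝ))‖ ^ 2)) * d)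
    (h₅ : ‖backflow n Φ‖ ^ 2 ≤ 4 * (C₃ * ((N : ℝ) * ksq L n)) * d) :
    (ksq L n * ‖condensateSource n Φ‖) ^ 2 ≤ 5 * (2 + 24 * Real.pi ^ 2 * C₂ + 4 * C₃) * ((N : ℝ) * ksq L n) * d := by
  have hK := norm_kCurrent_le n Φ
  have hX := ksq_mul_norm_condensateSource_le n Φ
  have h0 : 0 ≤ ksq L n * ‖condensateSource n Φ‖ := mul_nonneg (ksq_nonneg L n) (norm_nonneg _)
  have hgeom := ksq_mul_geom_le hL hn
  have hCN : 0 ≤ C₂ * (N : ℝ) := by positivity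
  have k₁ := abs_sq_le_of_two_mul h₁
  have k₂ := abs_sq_le_of_two_mul h₂
  have k₃ := density_term_sq (ksq_nonneg L n) hd hCN hgeom h₃
  have k₄ := density_term_sq (ksq_nonneg L n) hd hCN hgeom h₄
  have hT : ksq L n * ‖condensateSource n Φ‖ ≤
      ksq L n / 2 * |densityWave 0 n Φ| + ksq L n / 2 * |densityWave (-(Real.pi / 2)) n Φ| +
        |(phasedCurrent 0 n Φ).im| + |(phasedCurrent (-(Real.pi / 2)) n Φ).im| + ‖backflow n Φ‖ := by
    linarith [hK, hX]
  have key := sq_le_five_of_le_sum h0 hT k₃ k₄ k₁ k₂ h₅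
  linarith

/-- **§A at one state (square form).** Conversely, with the same Ward and density inputs and `(|k|²‖X‖)² ≤ 4Bd`:
`‖R‖² ≤ 5((2 + 24π²C₂)c_k + 4B)·d`. -/
theorem backflow_sq (hL : 0 < L) {d C₂ B : ℝ} {n : Fin 3 → ℤ} (hn : n ≠ 0) {Φ : PeriodicTrialState N L}
    (hd : 0 ≤ d) (hC₂ : 0 ≤ C₂)
    (h₁ : |2 * (phasedCurrent 0 n Φ).im| ^ 2 ≤ 4 * ((N : ℝ) * ksq L n) * d)
    (h₂ : |2 * (phasedCurrent (-(Real.pi / 2)) n Φ).im| ^ 2 ≤ 4 * ((N : ℝ) * ksq L n) * d)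
    (h₃ : |densityWave 0 n Φ| ^ 2 ≤ 4 * (C₂ * N * (L ^ 2 / ‖(fun j => (n j : ℝ))‖ ^ 2)) * d)
    (h₄ : |densityWave (-(Real.pi / 2)) n Φ| ^ 2 ≤ 4 * (C₂ * N * (L ^ 2 / ‖(fun j => (n j : ℝ))‖ ^ 2)) * d)
    (h₅ : (ksq L n * ‖condensateSource n Φ‖) ^ 2 ≤ 4 * B * d) :
    ‖backflow n Φ‖ ^ 2 ≤ 5 * ((2 + 24 * Real.pi ^ 2 * C₂) * ((N : ℝ) * ksq L n) + 4 * B) * d := by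
  have hK := norm_kCurrent_le n Φ
  have hR := norm_backflow_le n Φ
  have hgeom := ksq_mul_geom_le hL hn
  have hCN : 0 ≤ C₂ * (N : ℝ) := by positivity
  have k₁ := abs_sq_le_of_two_mul h₁
  have k₂ := abs_sq_le_of_two_mul h₂
  have k₃ := density_term_sq (ksq_nonneg L n) hd hCN hgeom h₃
  have k₄ := density_term_sq (ksq_nonneg L n) hd hCN hgeom h₄
  have hT : ‖backflow n Φ‖ ≤
      ksq L n / 2 * |densityWave 0 n Φ| + ksq L n / 2 * |densityWave (-(Real.pi / 2)) n Φ| +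
        |(phasedCurrent 0 n Φ).im| + |(phasedCurrent (-(Real.pi / 2)) n Φ).im| +
          ksq L n * ‖condensateSource n Φ‖ := by
    linarith [hK, hR]
  have key := sq_le_five_of_le_sum (norm_nonneg _) hT k₃ k₄ k₁ k₂ h₅
  linarith

/-- **The composition, c-number level**: WardChord ∧ S2 ∧ S3 ⟹ `CNumberGD` with `ρ₀ := min`,
`N₀ := max (max N₂ N₃) 1`, `C := 10 + 120π²C₂ + 20C₃` (from `(|k|²‖X‖)² ≤ 5(2+24π²C₂+4C₃)N|k|²(E-E₀)`,
`k∞² ≤ |k|²` and `k∞²L²/‖n‖² = 4π² ≥ 1`). -/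
theorem cnumberGD_of (h₁ : WardChord) (h₂ : WeakDensityChord) (h₃ : BackflowChord) : CNumberGD := by
  intro v hv M hM
  obtain ⟨ρ₂, C₂, hρ₂, hC₂, N₂, hD⟩ := h₂ v hv M hM
  obtain ⟨ρ₃, C₃, hρ₃, hC₃, N₃, hB⟩ := h₃ v hv M hM
  refine ⟨min ρ₂ ρ₃, 10 + 120 * Real.pi ^ 2 * C₂ + 20 * C₃, lt_min hρ₂ hρ₃, by positivity,
    max (max N₂ N₃) 1, ?_⟩
  intro N hN L hL hNL n hn hwin s hs Φ
  have hN₂ : N₂ ≤ N := ((le_max_left _ _).trans (le_max_left _ _)).trans hN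
  have hN₃ : N₃ ≤ N := ((le_max_right _ _).trans (le_max_left _ _)).trans hN
  have hN1 : 1 ≤ N := (le_max_right _ _).trans hN
  have hL3 : (0 : ℝ) ≤ L ^ 3 := by positivity
  have hNL₂ : (N : ℝ) ≤ ρ₂ * L ^ 3 := hNL.trans (mul_le_mul_of_nonneg_right (min_le_left _ _) hL3)
  have hNL₃ : (N : ℝ) ≤ ρ₃ * L ^ 3 := hNL.trans (mul_le_mul_of_nonneg_right (min_le_right _ _) hL3)
  -- infinite energy: nothing to prove
  by_cases hE : periodicEnergy v Φ = ⊤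
  · rw [hE, top_add]; exact le_top
  have hE₀E : periodicGroundStateEnergy v N L ≤ periodicEnergy v Φ := periodicGroundStateEnergy_le v Φ
  -- positivity
  have hNr : (1 : ℝ) ≤ N := by exact_mod_cast hN1
  have hk : 0 < ksq L n := ksq_pos hL.ne' hn
  have hck : 0 < (N : ℝ) * ksq L n := mul_pos (by linarith) hk
  have hnorm : 0 < ‖(fun j => (n j : ℝ))‖ := lt_of_lt_of_le one_pos (one_le_norm_intVec hn)
  have hcD : 0 < C₂ * N * (L ^ 2 / ‖(fun j => (n j : ℝ))‖ ^ 2) := by positivity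
  set d := (periodicEnergy v Φ).toReal - (periodicGroundStateEnergy v N L).toReal with hd
  have hd0 : 0 ≤ d := sub_nonneg.mpr (ENNReal.toReal_mono hE hE₀E)
  -- square forms of the five chords at `Φ`
  have q₁ : |2 * (phasedCurrent 0 n Φ).im| ^ 2 ≤ 4 * ((N : ℝ) * ksq L n) * d :=
    sq_le_of_ennreal_chords hE hE₀E (abs_nonneg _) hck fun s' hs' => by
      have h := h₁ v N L n 0 s' hs' Φ
      rwa [show s' ^ 2 * ((N : ℝ) * ksq L n) = (N : ℝ) * ksq L n * s' ^ 2 by ring] at h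
  have q₂ : |2 * (phasedCurrent (-(Real.pi / 2)) n Φ).im| ^ 2 ≤ 4 * ((N : ℝ) * ksq L n) * d :=
    sq_le_of_ennreal_chords hE hE₀E (abs_nonneg _) hck fun s' hs' => by
      have h := h₁ v N L n (-(Real.pi / 2)) s' hs' Φ
      rwa [show s' ^ 2 * ((N : ℝ) * ksq L n) = (N : ℝ) * ksq L n * s' ^ 2 by ring] at h
  have q₃ : |densityWave 0 n Φ| ^ 2 ≤ 4 * (C₂ * N * (L ^ 2 / ‖(fun j => (n j : ℝ))‖ ^ 2)) * d :=
    sq_le_of_ennreal_chords hE hE₀E (abs_nonneg _) hcD fun s' hs' => by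
      have h := hD N hN₂ L hL hNL₂ n hn hwin 0 s' hs' Φ
      rwa [show C₂ * s' ^ 2 * (N : ℝ) * L ^ 2 / ‖(fun j => (n j : ℝ))‖ ^ 2 =
        C₂ * N * (L ^ 2 / ‖(fun j => (n j : ℝ))‖ ^ 2) * s' ^ 2 by ring] at h
  have q₄ : |densityWave (-(Real.pi / 2)) n Φ| ^ 2 ≤ 4 * (C₂ * N * (L ^ 2 / ‖(fun j => (n j : ℝ))‖ ^ 2)) * d :=
    sq_le_of_ennreal_chords hE hE₀E (abs_nonneg _) hcD fun s' hs' => by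
      have h := hD N hN₂ L hL hNL₂ n hn hwin (-(Real.pi / 2)) s' hs' Φ
      rwa [show C₂ * s' ^ 2 * (N : ℝ) * L ^ 2 / ‖(fun j => (n j : ℝ))‖ ^ 2 =
        C₂ * N * (L ^ 2 / ‖(fun j => (n j : ℝ))‖ ^ 2) * s' ^ 2 by ring] at h
  have q₅ : ‖backflow n Φ‖ ^ 2 ≤ 4 * (C₃ * ((N : ℝ) * ksq L n)) * d :=
    sq_le_of_ennreal_chords hE hE₀E (norm_nonneg _) (mul_pos hC₃ hck) fun s' hs' => by
      have h := hB N hN₃ L hL hNL₃ n hn hwin s' hs' Φ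
      rwa [show C₃ * s' ^ 2 * ((N : ℝ) * ksq L n) = C₃ * ((N : ℝ) * ksq L n) * s' ^ 2 by ring] at h
  -- the splitting inequality and the passage to the crux's budget
  have key := splitting_sq hL hn hd0 hC₂.le q₁ q₂ q₃ q₄ q₅
  set F := ‖condensateSource n Φ‖ with hF
  have hF0 : 0 ≤ F := norm_nonneg _
  set K := 2 + 24 * Real.pi ^ 2 * C₂ + 4 * C₃ with hK
  have hK0 : 0 ≤ K := by positivity
  -- `k∞² F² ≤ |k|² F² ≤ 5K N d`
  have hk1 : ksq L n * F ^ 2 ≤ 5 * K * N * d := by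
    have h1 : ksq L n * (ksq L n * F ^ 2) ≤ ksq L n * (5 * K * N * d) := by
      calc ksq L n * (ksq L n * F ^ 2) = (ksq L n * F) ^ 2 := by ring
        _ ≤ 5 * K * ((N : ℝ) * ksq L n) * d := key
        _ = ksq L n * (5 * K * N * d) := by ring
    exact le_of_mul_le_mul_left h1 hk
  have hk2 : ksupSq L n * F ^ 2 ≤ 5 * K * N * d :=
    (mul_le_mul_of_nonneg_right (ksupSq_le_ksq L n) (sq_nonneg F)).trans hk1
  -- multiply by `L²/‖n‖²` and use `k∞² L²/‖n‖² = 4π² ≥ 1`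
  have hq : 0 ≤ L ^ 2 / ‖(fun j => (n j : ℝ))‖ ^ 2 := by positivity
  have hk3 : 4 * Real.pi ^ 2 * F ^ 2 ≤ 5 * K * N * d * (L ^ 2 / ‖(fun j => (n j : ℝ))‖ ^ 2) := by
    have h1 := mul_le_mul_of_nonneg_right hk2 hq
    calc 4 * Real.pi ^ 2 * F ^ 2 = ksupSq L n * (L ^ 2 / ‖(fun j => (n j : ℝ))‖ ^ 2) * F ^ 2 := by
          rw [ksupSq_mul hL hn]
      _ = ksupSq L n * F ^ 2 * (L ^ 2 / ‖(fun j => (n j : ℝ))‖ ^ 2) := by ring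
      _ ≤ 5 * K * N * d * (L ^ 2 / ‖(fun j => (n j : ℝ))‖ ^ 2) := h1
  have hπ : (1 : ℝ) ≤ 4 * Real.pi ^ 2 := by nlinarith [Real.pi_gt_three]
  have hKd : 0 ≤ 5 * K * N * d * (L ^ 2 / ‖(fun j => (n j : ℝ))‖ ^ 2) := by positivity
  have hsq : F ^ 2 ≤ 4 * ((10 + 120 * Real.pi ^ 2 * C₂ + 20 * C₃) * N * L ^ 2 / ‖(fun j => (n j : ℝ))‖ ^ 2) * d := by
    have h2 : F ^ 2 ≤ 4 * Real.pi ^ 2 * F ^ 2 := le_mul_of_one_le_left (sq_nonneg F) hπ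
    have h3 : 5 * K * N * d * (L ^ 2 / ‖(fun j => (n j : ℝ))‖ ^ 2) ≤
        4 * (5 * K * N * d * (L ^ 2 / ‖(fun j => (n j : ℝ))‖ ^ 2)) := le_mul_of_one_le_left hKd (by norm_num)
    have h4 : 4 * (5 * K * N * d * (L ^ 2 / ‖(fun j => (n j : ℝ))‖ ^ 2)) =
        4 * ((10 + 120 * Real.pi ^ 2 * C₂ + 20 * C₃) * N * L ^ 2 / ‖(fun j => (n j : ℝ))‖ ^ 2) * d := by
      rw [hK]; ring
    linarith
  -- back to the chord at the given `s`
  have hc : 0 < (10 + 120 * Real.pi ^ 2 * C₂ + 20 * C₃) * N * L ^ 2 / ‖(fun j => (n j : ℝ))‖ ^ 2 := by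
    positivity
  have hreal := forall_chord_of_sq_le hc hsq s
  refine (ennreal_chord_iff hE hE₀E (mul_nonneg hs hF0) (by positivity)).mpr ?_
  have e1 : (10 + 120 * Real.pi ^ 2 * C₂ + 20 * C₃) * s ^ 2 * (N : ℝ) * L ^ 2 / ‖(fun j => (n j : ℝ))‖ ^ 2 =
      (10 + 120 * Real.pi ^ 2 * C₂ + 20 * C₃) * N * L ^ 2 / ‖(fun j => (n j : ℝ))‖ ^ 2 * s ^ 2 := by ring
  rw [e1]
  linarith

/-- **§A of triage r1-3 as a theorem**: conversely WardChord ∧ S2 ∧ `CNumberGD` ⟹ S3 (`‖R‖ ≤ ‖kCurrent‖ + |k|²‖X‖`,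
`|k|² L²/‖n‖² ≤ 12π²`); so, modulo the (proved) Ward chord and the density chord, the backflow chord and c-number
Gaussian domination are EQUIVALENT. Constants: `C₃ := 2(2 + 24π²C₂ + 48π²C_X)`. -/
theorem backflowChord_of_cnumberGD (h₁ : WardChord) (h₂ : WeakDensityChord) (hX : CNumberGD) :
    BackflowChord := by
  intro v hv M hM
  obtain ⟨ρ₂, C₂, hρ₂, hC₂, N₂, hD⟩ := h₂ v hv M hM
  obtain ⟨ρ₃, C₃, hρ₃, hC₃, N₃, hC⟩ := hX v hv M hM
  refine ⟨min ρ₂ ρ₃, 2 * (2 + 24 * Real.pi ^ 2 * C₂ + 48 * Real.pi ^ 2 * C₃), lt_min hρ₂ hρ₃, by positivity,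
    max (max N₂ N₃) 1, ?_⟩
  intro N hN L hL hNL n hn hwin s hs Φ
  have hN₂ : N₂ ≤ N := ((le_max_left _ _).trans (le_max_left _ _)).trans hN
  have hN₃ : N₃ ≤ N := ((le_max_right _ _).trans (le_max_left _ _)).trans hN
  have hN1 : 1 ≤ N := (le_max_right _ _).trans hN
  have hL3 : (0 : ℝ) ≤ L ^ 3 := by positivity
  have hNL₂ : (N : ℝ) ≤ ρ₂ * L ^ 3 := hNL.trans (mul_le_mul_of_nonneg_right (min_le_left _ _) hL3)
  have hNL₃ : (N : ℝ) ≤ ρ₃ * L ^ 3 := hNL.trans (mul_le_mul_of_nonneg_right (min_le_right _ _) hL3)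
  by_cases hE : periodicEnergy v Φ = ⊤
  · rw [hE, top_add]; exact le_top
  have hE₀E : periodicGroundStateEnergy v N L ≤ periodicEnergy v Φ := periodicGroundStateEnergy_le v Φ
  have hNr : (1 : ℝ) ≤ N := by exact_mod_cast hN1
  have hk : 0 < ksq L n := ksq_pos hL.ne' hn
  have hck : 0 < (N : ℝ) * ksq L n := mul_pos (by linarith) hk
  have hnorm : 0 < ‖(fun j => (n j : ℝ))‖ := lt_of_lt_of_le one_pos (one_le_norm_intVec hn)
  have hcD : 0 < C₂ * N * (L ^ 2 / ‖(fun j => (n j : ℝ))‖ ^ 2) := by positivity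
  set d := (periodicEnergy v Φ).toReal - (periodicGroundStateEnergy v N L).toReal with hd
  have hd0 : 0 ≤ d := sub_nonneg.mpr (ENNReal.toReal_mono hE hE₀E)
  have q₁ : |2 * (phasedCurrent 0 n Φ).im| ^ 2 ≤ 4 * ((N : ℝ) * ksq L n) * d :=
    sq_le_of_ennreal_chords hE hE₀E (abs_nonneg _) hck fun s' hs' => by
      have h := h₁ v N L n 0 s' hs' Φ
      rwa [show s' ^ 2 * ((N : ℝ) * ksq L n) = (N : ℝ) * ksq L n * s' ^ 2 by ring] at h
  have q₂ : |2 * (phasedCurrent (-(Real.pi / 2)) n Φ).im| ^ 2 ≤ 4 * ((N : ℝ) * ksq L n) * d :=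
    sq_le_of_ennreal_chords hE hE₀E (abs_nonneg _) hck fun s' hs' => by
      have h := h₁ v N L n (-(Real.pi / 2)) s' hs' Φ
      rwa [show s' ^ 2 * ((N : ℝ) * ksq L n) = (N : ℝ) * ksq L n * s' ^ 2 by ring] at h
  have q₃ : |densityWave 0 n Φ| ^ 2 ≤ 4 * (C₂ * N * (L ^ 2 / ‖(fun j => (n j : ℝ))‖ ^ 2)) * d :=
    sq_le_of_ennreal_chords hE hE₀E (abs_nonneg _) hcD fun s' hs' => by
      have h := hD N hN₂ L hL hNL₂ n hn hwin 0 s' hs' Φ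
      rwa [show C₂ * s' ^ 2 * (N : ℝ) * L ^ 2 / ‖(fun j => (n j : ℝ))‖ ^ 2 =
        C₂ * N * (L ^ 2 / ‖(fun j => (n j : ℝ))‖ ^ 2) * s' ^ 2 by ring] at h
  have q₄ : |densityWave (-(Real.pi / 2)) n Φ| ^ 2 ≤ 4 * (C₂ * N * (L ^ 2 / ‖(fun j => (n j : ℝ))‖ ^ 2)) * d :=
    sq_le_of_ennreal_chords hE hE₀E (abs_nonneg _) hcD fun s' hs' => by
      have h := hD N hN₂ L hL hNL₂ n hn hwin (-(Real.pi / 2)) s' hs' Φ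
      rwa [show C₂ * s' ^ 2 * (N : ℝ) * L ^ 2 / ‖(fun j => (n j : ℝ))‖ ^ 2 =
        C₂ * N * (L ^ 2 / ‖(fun j => (n j : ℝ))‖ ^ 2) * s' ^ 2 by ring] at h
  have hcX : 0 < C₃ * N * L ^ 2 / ‖(fun j => (n j : ℝ))‖ ^ 2 := by positivity
  have q₅ : ‖condensateSource n Φ‖ ^ 2 ≤ 4 * (C₃ * N * L ^ 2 / ‖(fun j => (n j : ℝ))‖ ^ 2) * d :=
    sq_le_of_ennreal_chords hE hE₀E (norm_nonneg _) hcX fun s' hs' => by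
      have h := hC N hN₃ L hL hNL₃ n hn hwin s' hs' Φ
      rwa [show C₃ * s' ^ 2 * (N : ℝ) * L ^ 2 / ‖(fun j => (n j : ℝ))‖ ^ 2 =
        C₃ * N * L ^ 2 / ‖(fun j => (n j : ℝ))‖ ^ 2 * s' ^ 2 by ring] at h
  set F := ‖condensateSource n Φ‖ with hF
  -- `(|k|²‖X‖)² ≤ 4 C₃ N (|k|² L²/‖n‖²) |k|² d ≤ 4 (12π² C₃ N|k|²) d`
  have hgeom := ksq_mul_geom_le hL hn
  have q₅' : (ksq L n * F) ^ 2 ≤ 4 * (12 * Real.pi ^ 2 * C₃ * ((N : ℝ) * ksq L n)) * d := by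
    have h1 : ksq L n * F ^ 2 ≤ ksq L n * (4 * (C₃ * N * L ^ 2 / ‖(fun j => (n j : ℝ))‖ ^ 2) * d) :=
      mul_le_mul_of_nonneg_left q₅ hk.le
    have h2 : ksq L n * (4 * (C₃ * N * L ^ 2 / ‖(fun j => (n j : ℝ))‖ ^ 2) * d) =
        4 * C₃ * N * d * (ksq L n * (L ^ 2 / ‖(fun j => (n j : ℝ))‖ ^ 2)) := by ring
    have h3 : 0 ≤ 4 * C₃ * N * d := by positivity
    have h4 : 4 * C₃ * N * d * (ksq L n * (L ^ 2 / ‖(fun j => (n j : ℝ))‖ ^ 2)) ≤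
        4 * C₃ * N * d * (12 * Real.pi ^ 2) := mul_le_mul_of_nonneg_left hgeom h3
    have h5 : ksq L n * F ^ 2 ≤ 4 * C₃ * N * d * (12 * Real.pi ^ 2) := by linarith
    have h6 := mul_le_mul_of_nonneg_left h5 hk.le
    calc (ksq L n * F) ^ 2 = ksq L n * (ksq L n * F ^ 2) := by ring
      _ ≤ ksq L n * (4 * C₃ * N * d * (12 * Real.pi ^ 2)) := h6
      _ = 4 * (12 * Real.pi ^ 2 * C₃ * ((N : ℝ) * ksq L n)) * d := by ring
  have key := backflow_sq hL hn hd0 hC₂.le q₁ q₂ q₃ q₄ q₅'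
  have hsqR : ‖backflow n Φ‖ ^ 2 ≤
      4 * (2 * (2 + 24 * Real.pi ^ 2 * C₂ + 48 * Real.pi ^ 2 * C₃) * ((N : ℝ) * ksq L n)) * d := by
    have h0 : 0 ≤ (2 + 24 * Real.pi ^ 2 * C₂ + 48 * Real.pi ^ 2 * C₃) * ((N : ℝ) * ksq L n) * d := by positivity
    have h1 : 5 * ((2 + 24 * Real.pi ^ 2 * C₂) * ((N : ℝ) * ksq L n) +
        4 * (12 * Real.pi ^ 2 * C₃ * ((N : ℝ) * ksq L n))) * d
        = 5 * ((2 + 24 * Real.pi ^ 2 * C₂ + 48 * Real.pi ^ 2 * C₃) * ((N : ℝ) * ksq L n) * d) := by ring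
    have h2 : 4 * (2 * (2 + 24 * Real.pi ^ 2 * C₂ + 48 * Real.pi ^ 2 * C₃) * ((N : ℝ) * ksq L n)) * d
        = 8 * ((2 + 24 * Real.pi ^ 2 * C₂ + 48 * Real.pi ^ 2 * C₃) * ((N : ℝ) * ksq L n) * d) := by ring
    linarith
  have hc : 0 < 2 * (2 + 24 * Real.pi ^ 2 * C₂ + 48 * Real.pi ^ 2 * C₃) * ((N : ℝ) * ksq L n) := by positivity
  have hreal := forall_chord_of_sq_le hc hsqR s
  refine (ennreal_chord_iff hE hE₀E (mul_nonneg hs (norm_nonneg _)) (by positivity)).mpr ?_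
  have e1 : 2 * (2 + 24 * Real.pi ^ 2 * C₂ + 48 * Real.pi ^ 2 * C₃) * s ^ 2 * ((N : ℝ) * ksq L n) =
      2 * (2 + 24 * Real.pi ^ 2 * C₂ + 48 * Real.pi ^ 2 * C₃) * ((N : ℝ) * ksq L n) * s ^ 2 := by ring
  rw [e1]
  linarith

end Composition

/-- **The composition**: the three stubs imply the crux BY NAME — the proved Ward chord `wardChord` (S1) and the stubs
S2, S3 give `CNumberGD` (`cnumberGD_of`), the lift S4 turns it into `∀ v M ∃ ρ₀ C N₀, GDCanWith ρ₀ C N₀ v M`, and the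
disprover's `gaussianDominationCan_iff` (`Iff.rfl`) identifies that with the route decl. -/
theorem GaussianDominationCan_of :
    Goal.stub_weakDensityChord → Goal.stub_backflowChord → Goal.stub_normalisationLift →
      BECThomsonPrinciple.GaussianDominationCan :=
  fun h₂ h₃ h₄ => gaussianDominationCan_iff.mpr (h₄ (cnumberGD_of wardChord h₂ h₃))

/-- **Variant composition through the sibling crux**: the route item `DensityResponse` (rank 4) in place of S2 —
so the crux is `DensityResponse ∧ S3 ∧ S4` with everything else proved in this file. -/
theorem GaussianDominationCan_of_densityResponse :
    Goal.stub_backflowChord → Goal.stub_normalisationLift → BECThomsonPrinciple.DensityResponse →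
      BECThomsonPrinciple.GaussianDominationCan :=
  fun h₃ h₄ hD => GaussianDominationCan_of (weakDensityChord_of_densityResponse hD) h₃ h₄

/-- The skeleton as a (sorried-through-the-stubs) proof of the crux: `_of` applied to the three stubs. -/
theorem GaussianDominationCan_proof : BECThomsonPrinciple.GaussianDominationCan :=
  GaussianDominationCan_of stub_weakDensityChord stub_backflowChord stub_normalisationLift

end

end Summit.AtomisticToContinuum.BoseEinsteinCondensation.Cruxes.GaussianDominationCan.WardChordSplitting
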